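import Literature.NumberTheory.EllipticCurves.QuadOrderPicardTower
import Literature.NumberTheory.EllipticCurves.GrossPointsThetaElementFacts
import Literature.NumberTheory.Automorphic.EichlerSubidealCount
import Literature.NumberTheory.Automorphic.BrandtModuleWeightSymmProofs
import Literature.NumberTheory.Automorphic.BrandtMatrixClassFunction
import Literature.NumberTheory.Automorphic.BrandtColumnSums
import Literature.NumberTheory.Automorphic.BrandtModuleMultiplicativity
import Literature.NumberTheory.Automorphic.BrandtWeightSymmetry
import Literature.NumberTheory.Automorphic.BrandtModuleDictionary
import HarnessLib

/-!
# Norm relations of Gross points along the `p`-tower and the compatibility of the theta elements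
# (Bertolini–Darmon 1996, §2.4 (5) and Prop. 2.7) — discharge of `grossPointTower_isNormCompatible`

Topic `NumberTheory/EllipticCurves` (sequel of `GrossPointsThetaElement.lean`,
`GrossPointsThetaElementFacts.lean`, `QuadOrderPicardTower.lean`). THEOREMS (and one auxiliary
`Prop`-valued definition `HeegnerStable`, proved as `HeegnerStable_holds`); no named fact, no
`sorry`, no instance, no notation.

Bertolini–Darmon, *Heegner points on Mumford–Tate curves*, Invent. Math. 126 (1996):
§2.4 (5) "`u⁻¹ Norm_{K_{n+1}/K_n} P_{n+1} = T_p P_n − P_{n−1}` for `n ≥ 1`" and Prop. 2.7 "the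
elements `θ_n` are compatible under the natural projections … a direct calculation". In the
ideal-theoretic model of the tree (`GrossSpace`, `grossPoints`, `GrossPointTower`, `picRes`, the
Brandt matrix `Brandt.matrix S.O p` and the pairing `yValue`), we prove:

* §2 `relIndex_embLattice_mul_eq`: translation by an invertible `𝒪_c`-ideal (`p ∣ c`) preserves
  the index of `𝒪_c`-saturated lattices `pX ⊆ Y ⊆ X` (via integral representatives prime to `p`,
  `QuadOrderTower.exists_mk_eq_le_one_not_inM`; this replaces the local principality of `𝔟`);
* §3 `subideals_eq`: for a tower `(f, J₀) ≺ (f, J) ≺ (f, I)` of Heegner representatives of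
  conductors `e, c = ep, d = cp` and an invertible `𝒪_d`-ideal `𝔞`, the `p + 1` invertible
  sub-ideals of index `p²` of `f(𝔞)J` (Eichler's count, `Brandt.XiSetup.ncard_subideals_eq_prime_add_one`)
  are `f(𝔞)J₀` and the `p` lattices `p · f(𝔞_k 𝔞) I`, `𝔞_k` the kernel ideals of
  `QuadOrderPicardTower` ("`P̄_{n+1} = P_n`" and the conjugates of `P_{n+1}` over `K_n`);
* §4 `sum_subideals_yValue_eq`: the eigen-equation `T(p)φ = aφ` read at an arbitrary right ideal,
  `Σ_{M} w_[M] φ_[M] = a w_[J] φ_[J]` (weight symmetry `w_i T_ij = w_j T_ji`, Eichler);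
* §5 `norm_relation`: **`Σ_{res σ = τ} ⟨σ x_{n+2}, φ⟩ = a ⟨τ x_{n+1}, φ⟩ − ⟨τ̄ x_n, φ⟩`** for every
  `τ ∈ Pic(𝒪_{p^{n+1}})` (BD96 (5) paired with `φ`);
* §6 `GrossPointTowerNormCompat.isNormCompatible` and
  **`grossPointTower_isNormCompatible_holds`**: Prop. 2.7, `Σ_{res σ = τ} z_{n+2}(σ) = z_{n+1}(τ)`
  from the norm relation, `#fibre = p` and `α² = aα − p`.

The section `NormCompatAux` is a private verbatim copy of the toolkit of
`GrossPointsPicardActionHeegner.lean` (BD96 §2.3 (4): `(f, f(𝔞)I)` is again Heegner), whose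
compiled module could not be imported on the hub when this file was written.

## References

* [BertoliniDarmon1996] §2.3 (4), §2.4 (5), §2.5, Prop. 2.7 (pp. 431–436).
* [Eichler1973] Ch. II §6, (16)–(17) (the `p + 1` neighbours; `w_i B_ij = w_j B_ji`).
* [Cox2013] §7.D (ring class groups of orders; used through `QuadOrderPicardTower`).
* [Voight2021] §16.5–16.6 (invertible lattices; the copied toolkit).
-/

noncomputable section

open scoped nonZeroDivisors Pointwise
open NumberField Module
open Literature.NumberTheory.QuadraticFields.Quadratic



namespace Literature.NumberTheory.EllipticCurves

namespace GrossPointTowerNorm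

open QuadOrderTower Literature.NumberTheory.Automorphic GrossRep
open scoped Matrix

universe u'

variable {K : Type u'} [Field K] [NumberField K] {Nplus Nminus : ℕ} {S : Brandt.XiSetup Nplus Nminus}

/-! ### §1 Lattice toolkit: central elements, saturated lattices -/

/-- `ν • X = p • X` for the central unit `ν = p · 1`. [folklore] -/
private theorem units_smul_eq_zsmul {ν : S.Dˣ} {n : ℕ} (hν : (ν : S.D) = (n : ℤ))
    (X : Submodule ℤ S.D) : ν • X = (n : ℤ) • X := by
  ext x
  rw [Units.smul_def, Submodule.mem_smul_pointwise_iff_exists, Submodule.mem_smul_pointwise_iff_exists]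
  constructor
  · rintro ⟨s, hs, rfl⟩
    exact ⟨s, hs, by rw [hν, smul_eq_mul, zsmul_eq_mul]⟩
  · rintro ⟨s, hs, rfl⟩
    exact ⟨s, hs, by rw [hν, smul_eq_mul, zsmul_eq_mul]⟩

/-- `n • (A X) = A (n • X)` for lattices `A, X ⊆ D` and an integer `n`. [folklore] -/
private theorem zsmul_mul_eq (n : ℤ) (A X : Submodule ℤ S.D) : n • (A * X) = A * (n • X) := by
  have h := Submodule.mul_smul_mul_eq_smul_mul_smul A X (1 : ℤ) n
  rwa [one_mul, one_smul] at h

omit [NumberField K] in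
/-- `𝒪_c · L(𝔟) = L(𝔟)` for a fractional `𝒪_c`-ideal `𝔟` (its lattice is an `𝒪_c`-module). [folklore] -/
private theorem quadOrder_mul_fracIdealLattice (c : ℕ) (I : FractionalIdeal (quadOrder K c)⁰ K) :
    Subalgebra.toSubmodule (quadOrder K c) * fracIdealLattice c I = fracIdealLattice c I := by
  rw [← fracIdealLattice_one, ← fracIdealLattice_mul, one_mul]

/-- `f(𝒪_c) (f(L𝔟) X) = f(L𝔟) X`: translates by fractional ideals stay `𝒪_c`-saturated. [folklore] -/
private theorem embLattice_quadOrder_mul_embLattice_mul (f : K →ₐ[ℚ] S.D) (c : ℕ)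
    (I : FractionalIdeal (quadOrder K c)⁰ K) (X : Submodule ℤ S.D) :
    embLattice f (Subalgebra.toSubmodule (quadOrder K c)) * (embLattice f (fracIdealLattice c I) * X) =
      embLattice f (fracIdealLattice c I) * X := by
  rw [← mul_assoc, ← embLattice_mul, quadOrder_mul_fracIdealLattice]

/-- `f((ℤ y) 𝒪_c) X = f(y) • X` for an `𝒪_c`-saturated `X`. [folklore] -/
private theorem embLattice_spanSingleton_mul (f : K →ₐ[ℚ] S.D) (c : ℕ) [NeZero c] (y : K)
    {X : Submodule ℤ S.D} (hX : embLattice f (Subalgebra.toSubmodule (quadOrder K c)) * X = X) :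
    embLattice f (fracIdealLattice c (FractionalIdeal.spanSingleton (quadOrder K c)⁰ y)) * X =
      (f y) • X := by
  rw [fracIdealLattice_spanSingleton, embLattice_mul, mul_assoc, hX, embLattice, Submodule.map_span,
    Set.image_singleton]
  exact Submodule.span_singleton_mul

/-- `f(L(𝔟₁ 𝔟₂)) X = f(L𝔟₂) (f(L𝔟₁) X)`. [folklore] -/
private theorem embLattice_fracIdealLattice_mul_mul (f : K →ₐ[ℚ] S.D) (c : ℕ)
    (I J : FractionalIdeal (quadOrder K c)⁰ K) (X : Submodule ℤ S.D) :
    embLattice f (fracIdealLattice c (I * J)) * X =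
      embLattice f (fracIdealLattice c J) * (embLattice f (fracIdealLattice c I) * X) := by
  rw [fracIdealLattice_mul, mul_comm (fracIdealLattice c I), embLattice_mul, mul_assoc]

/-- Translation by a unit of `D` acting through `f`: `[f(y) X : f(y) Y] = [X : Y]`. [folklore] -/
private theorem relIndex_smul_apply (f : K →ₐ[ℚ] S.D) {y : K} (hy : y ≠ 0) (X Y : Submodule ℤ S.D) :
    ((f y) • Y).toAddSubgroup.relIndex ((f y) • X).toAddSubgroup =
      Y.toAddSubgroup.relIndex X.toAddSubgroup := by
  have h := Brandt.relIndex_units_smul (GrossSpace.embUnit f (Units.mk0 y hy)) Y X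
  rwa [Units.smul_def, Units.smul_def, GrossSpace.val_embUnit, Units.val_mk0] at h

/-! ### §2 Translation by an invertible `𝒪_c`-ideal preserves indices of saturated lattices -/

section Index

variable {c : ℕ} [NeZero c] {b : Basis (Fin 2) ℤ (𝓞 K)} (hb : b 0 = 1) {p : ℕ} [hp : Fact p.Prime]

omit [NeZero c] in
include hb in
/-- Core of the index lemma: for an integral `𝒪_c`-ideal `𝔟₁` containing an element outside
`𝔪 = pℤ + c𝓞_K` (so `𝔟₁ + p𝒪_c = 𝒪_c`), and `𝒪_c`-saturated lattices `pX ⊆ Y ⊆ X`, one has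
`f(𝔟₁)X + Y = X`, hence `[X : Y] = [f(𝔟₁)X : f(𝔟₁)X ∩ Y]` divides `[f(𝔟₁)X : f(𝔟₁)Y]`. [folklore] -/
private theorem relIndex_dvd_of_coprime (hpc : p ∣ c) (f : K →ₐ[ℚ] S.D)
    {B₁ : FractionalIdeal (quadOrder K c)⁰ K} (hB₁ : B₁ ≤ 1) {β : K} (hβ : β ∈ B₁)
    (hβm : ¬ InM b c p β) {X Y : Submodule ℤ S.D}
    (hX : embLattice f (Subalgebra.toSubmodule (quadOrder K c)) * X = X)
    (hY : embLattice f (Subalgebra.toSubmodule (quadOrder K c)) * Y = Y)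
    (hYX : Y ≤ X) (hpX : (p : ℤ) • X ≤ Y) :
    Y.toAddSubgroup.relIndex X.toAddSubgroup ∣
      (embLattice f (fracIdealLattice c B₁) * Y).toAddSubgroup.relIndex
        (embLattice f (fracIdealLattice c B₁) * X).toAddSubgroup := by
  set A := embLattice f (fracIdealLattice c B₁) with hA
  -- `β ∈ 𝒪_c ∖ 𝔪`: `β w = 1 + p z`
  have hβO : β ∈ quadOrder K c := by
    obtain ⟨v, hv⟩ := (FractionalIdeal.mem_one_iff _).mp (hB₁ hβ); rw [← hv]; exact v.2
  obtain ⟨Xc, Yc, hYc, hβe⟩ := (mem_quadOrder_iff_coords b hb).mp hβO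
  have hXc : ¬ (p : ℤ) ∣ Xc := fun h => hβm ⟨Xc, Yc, h, hYc, hβe⟩
  obtain ⟨w, hw, z, hz, hwz⟩ := exists_mul_eq_one_add_of_not_dvd (K := K) hb hp.out hpc hXc hYc
  rw [← hβe] at hwz
  have hLO : fracIdealLattice c B₁ ≤ Subalgebra.toSubmodule (quadOrder K c) := fun v hv => by
    obtain ⟨v', hv'⟩ := (FractionalIdeal.mem_one_iff _).mp (hB₁ ((mem_fracIdealLattice_iff).mp hv))
    rw [← hv']; exact v'.2
  have hAO : A ≤ embLattice f (Subalgebra.toSubmodule (quadOrder K c)) := Submodule.map_mono hLO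
  have hAX : A * X ≤ X := by
    calc A * X ≤ embLattice f (Subalgebra.toSubmodule (quadOrder K c)) * X := mul_le_mul' hAO le_rfl
      _ = X := hX
  have hAY : A * Y ≤ Y := by
    calc A * Y ≤ embLattice f (Subalgebra.toSubmodule (quadOrder K c)) * Y := mul_le_mul' hAO le_rfl
      _ = Y := hY
  -- `X = A X + Y`
  have hsup : X = A * X ⊔ Y := by
    refine le_antisymm (fun x hx => ?_) (sup_le hAX hYX)
    have hwx : f w * x ∈ X := by
      rw [← hX]; exact Submodule.mul_mem_mul (apply_mem_embLattice f (by exact hw)) hx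
    have e : x = f β * (f w * x) - (p : ℤ) • (f z * x) := by
      rw [← mul_assoc, ← map_mul, hwz, map_add, map_one, map_mul, map_natCast, add_mul, one_mul,
        zsmul_eq_mul, Int.cast_natCast, mul_assoc, add_sub_cancel_right]
    have hzx : f z * x ∈ X := by
      rw [← hX]; exact Submodule.mul_mem_mul (apply_mem_embLattice f (by exact hz)) hx
    rw [e]
    exact Submodule.sub_mem _ (Submodule.mem_sup_left (Submodule.mul_mem_mul
      (apply_mem_embLattice f ((mem_fracIdealLattice_iff).mpr hβ)) hwx))
      (Submodule.mem_sup_right (hpX (Submodule.smul_mem_pointwise_smul _ (p : ℤ) X hzx)))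
  -- second isomorphism theorem: `[X : Y] = [A X : Y ∩ A X]`, and `A Y ⊆ Y ∩ A X ⊆ A X`
  have h2 : Y.toAddSubgroup.relIndex X.toAddSubgroup =
      (Y.toAddSubgroup ⊓ (A * X).toAddSubgroup).relIndex (A * X).toAddSubgroup := by
    conv_lhs => rw [hsup]
    rw [Submodule.sup_toAddSubgroup, AddSubgroup.relIndex_sup_right, AddSubgroup.inf_relIndex_right]
  have hAYle : (A * Y).toAddSubgroup ≤ Y.toAddSubgroup ⊓ (A * X).toAddSubgroup :=
    le_inf (fun v hv => hAY hv) (fun v hv => (mul_le_mul' (le_refl A) hYX) hv)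
  rw [h2]
  exact Dvd.intro_left _ (AddSubgroup.relIndex_mul_relIndex _ _ _ hAYle
    (inf_le_right : Y.toAddSubgroup ⊓ (A * X).toAddSubgroup ≤ (A * X).toAddSubgroup))

include hb in
/-- **Translation by an invertible `𝒪_c`-ideal preserves relative indices of `𝒪_c`-saturated
lattices** (`p ∣ c`, `pX ⊆ Y ⊆ X`): `[f(𝔟)X : f(𝔟)Y] = [X : Y]`. (Locally `𝔟` is principal; here:
replace `𝔟` by an integral representative `𝔟₁` prime to `p` of its class and `𝔟₁⁻¹` by such a
`𝔟₂` with `𝔟₁𝔟₂ = (y)`; then `[X:Y] ∣ [𝔟₁X : 𝔟₁Y] ∣ [yX : yY] = [X:Y]`.) This is the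
translation-invariance behind "the Galois action commutes with `T_p`" in BD96 §2.4. [cite: BertoliniDarmon1996, §2.3 (4), §2.4 (5)] -/
theorem relIndex_embLattice_mul_eq (hpc : p ∣ c) (f : K →ₐ[ℚ] S.D)
    (𝔟 : (FractionalIdeal (quadOrder K c)⁰ K)ˣ) {X Y : Submodule ℤ S.D}
    (hX : embLattice f (Subalgebra.toSubmodule (quadOrder K c)) * X = X)
    (hY : embLattice f (Subalgebra.toSubmodule (quadOrder K c)) * Y = Y)
    (hYX : Y ≤ X) (hpX : (p : ℤ) • X ≤ Y) :
    (embLattice f (fracIdealLattice c (𝔟 : FractionalIdeal (quadOrder K c)⁰ K)) * Y).toAddSubgroup.relIndex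
        (embLattice f (fracIdealLattice c (𝔟 : FractionalIdeal (quadOrder K c)⁰ K)) * X).toAddSubgroup =
      Y.toAddSubgroup.relIndex X.toAddSubgroup := by
  -- coprime integral representatives `𝔟₁ ~ 𝔟`, `𝔟₂ ~ 𝔟₁⁻¹`, `𝔟₁ 𝔟₂ = (y)`, `𝔟 = 𝔟₁ (x)`
  obtain ⟨𝔟₁, h𝔟₁, hle₁, β₁, hβ₁, hβ₁m⟩ := exists_mk_eq_le_one_not_inM (c := c) hb (p := p) 𝔟
  obtain ⟨x, hx⟩ := mk_eq_mk_iff.mp h𝔟₁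
  obtain ⟨𝔟₂, h𝔟₂, hle₂, β₂, hβ₂, hβ₂m⟩ := exists_mk_eq_le_one_not_inM (c := c) hb (p := p) 𝔟₁⁻¹
  have hprin : (((𝔟₁ * 𝔟₂ : (FractionalIdeal (quadOrder K c)⁰ K)ˣ) : FractionalIdeal (quadOrder K c)⁰ K) :
      Submodule (quadOrder K c) K).IsPrincipal := by
    rw [← ClassGroup.mk_eq_one_iff, map_mul, h𝔟₂, ← map_mul, mul_inv_cancel, map_one]
  obtain ⟨y, hy⟩ := (FractionalIdeal.isPrincipal_iff _).mp hprin
  have hy0 : y ≠ 0 := by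
    intro h0
    rw [h0, FractionalIdeal.spanSingleton_zero] at hy
    exact (𝔟₁ * 𝔟₂).ne_zero hy
  -- the lattices `X₁ = f(𝔟₁) X ⊇ Y₁ = f(𝔟₁) Y` satisfy the same hypotheses
  have hX₁ := embLattice_quadOrder_mul_embLattice_mul f c (𝔟₁ : FractionalIdeal (quadOrder K c)⁰ K) X
  have hY₁ := embLattice_quadOrder_mul_embLattice_mul f c (𝔟₁ : FractionalIdeal (quadOrder K c)⁰ K) Y
  have hYX₁ : embLattice f (fracIdealLattice c (𝔟₁ : FractionalIdeal (quadOrder K c)⁰ K)) * Y ≤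
      embLattice f (fracIdealLattice c (𝔟₁ : FractionalIdeal (quadOrder K c)⁰ K)) * X :=
    mul_le_mul' le_rfl hYX
  have hpX₁ : (p : ℤ) • (embLattice f (fracIdealLattice c (𝔟₁ : FractionalIdeal (quadOrder K c)⁰ K)) * X) ≤
      embLattice f (fracIdealLattice c (𝔟₁ : FractionalIdeal (quadOrder K c)⁰ K)) * Y := by
    rw [zsmul_mul_eq]; exact mul_le_mul' le_rfl hpX
  have hd1 := relIndex_dvd_of_coprime hb hpc f hle₁ hβ₁ hβ₁m hX hY hYX hpX
  have hd2 := relIndex_dvd_of_coprime hb hpc f hle₂ hβ₂ hβ₂m hX₁ hY₁ hYX₁ hpX₁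
  -- `f(𝔟₂) (f(𝔟₁) Z) = f(y) Z`
  have hZ : ∀ {Z : Submodule ℤ S.D}, embLattice f (Subalgebra.toSubmodule (quadOrder K c)) * Z = Z →
      embLattice f (fracIdealLattice c (𝔟₂ : FractionalIdeal (quadOrder K c)⁰ K)) *
        (embLattice f (fracIdealLattice c (𝔟₁ : FractionalIdeal (quadOrder K c)⁰ K)) * Z) = (f y) • Z :=
    fun hZ => by
      rw [← embLattice_fracIdealLattice_mul_mul, ← Units.val_mul, hy, embLattice_spanSingleton_mul f c y hZ]
  rw [hZ hX, hZ hY, relIndex_smul_apply f hy0] at hd2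
  have heq₁ := Nat.dvd_antisymm hd1 hd2
  -- back to `𝔟 = 𝔟₁ (x)`
  have h𝔟 : ((𝔟 : (FractionalIdeal (quadOrder K c)⁰ K)ˣ) : FractionalIdeal (quadOrder K c)⁰ K) =
      𝔟₁ * FractionalIdeal.spanSingleton (quadOrder K c)⁰ (x : K) := by
    rw [← hx, Units.val_mul, coe_toPrincipalIdeal]
  have hZ' : ∀ {Z : Submodule ℤ S.D}, embLattice f (Subalgebra.toSubmodule (quadOrder K c)) * Z = Z →
      embLattice f (fracIdealLattice c (𝔟 : FractionalIdeal (quadOrder K c)⁰ K)) * Z =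
        (f x) • (embLattice f (fracIdealLattice c (𝔟₁ : FractionalIdeal (quadOrder K c)⁰ K)) * Z) :=
    fun {Z} hZ0 => by
      rw [h𝔟, embLattice_fracIdealLattice_mul_mul, embLattice_spanSingleton_mul f c (x : K)
        (embLattice_quadOrder_mul_embLattice_mul f c _ Z)]
  rw [hZ' hX, hZ' hY, relIndex_smul_apply f x.ne_zero]
  exact heq₁.symm

end Index

/-! ### §3 The `p + 1` neighbours of a translated tower point -/

section Neighbours

variable {b : Basis (Fin 2) ℤ (𝓞 K)} (hb : b 0 = 1) {p : ℕ} [hp : Fact p.Prime]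

/-- A Heegner representative of conductor `c` has an `𝒪_c`-saturated lattice: `f(𝒪_c) I = I`. [folklore] -/
private theorem sat_of_isHeegner {c : ℕ} {f : K →ₐ[ℚ] S.D} {I : Submodule ℤ S.D}
    (hr : (⟨f, I⟩ : GrossRep S.D K).IsHeegner S.O c) :
    embLattice f (Subalgebra.toSubmodule (quadOrder K c)) * I = I := by
  refine le_antisymm ?_ fun m hm => ?_
  · rw [Submodule.mul_le]
    rintro _ ⟨a, ha, rfl⟩ m hm
    exact (hr.2 a).mpr ha m hm
  · have h1 : f 1 ∈ embLattice f (Subalgebra.toSubmodule (quadOrder K c)) :=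
      apply_mem_embLattice _ (Subalgebra.one_mem _)
    simpa using Submodule.mul_mem_mul h1 hm

/-- Saturation descends along `𝒪_d ⊆ 𝒪_c` (`c ∣ d`): `f(𝒪_c) X = X ⇒ f(𝒪_d) X = X`. [folklore] -/
private theorem sat_of_dvd {c d : ℕ} (h : c ∣ d) (f : K →ₐ[ℚ] S.D) {X : Submodule ℤ S.D}
    (hX : embLattice f (Subalgebra.toSubmodule (quadOrder K c)) * X = X) :
    embLattice f (Subalgebra.toSubmodule (quadOrder K d)) * X = X := by
  refine le_antisymm ?_ fun m hm => ?_
  · calc _ ≤ embLattice f (Subalgebra.toSubmodule (quadOrder K c)) * X :=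
          mul_le_mul' (Submodule.map_mono (fun x hx => quadOrder_le_of_dvd h hx)) le_rfl
      _ = X := hX
  · have h1 : f 1 ∈ embLattice f (Subalgebra.toSubmodule (quadOrder K d)) :=
      apply_mem_embLattice _ (Subalgebra.one_mem _)
    simpa using Submodule.mul_mem_mul h1 hm

include hb in
/-- **The conductor of a Heegner representative is well defined** (`K` quadratic): optimal for
`𝒪_e` and for `𝒪_d` forces `e = d`. [cite: BertoliniDarmon1996, §2.1] -/
theorem conductor_unique {e d : ℕ} {r : GrossRep S.D K} (he : r.IsHeegner S.O e)
    (hd : r.IsHeegner S.O d) : e = d := by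
  have hed : ∀ x : K, x ∈ quadOrder K e ↔ x ∈ quadOrder K d := fun x => (he.2 x).symm.trans (hd.2 x)
  have h1 : (d : ℤ) ∣ e := by
    by_contra h
    exact natCast_mul_omega_not_mem b hb h ((hed _).mp (by
      exact_mod_cast intCast_mul_omega_mem b hb (dvd_refl (e : ℤ))))
  have h2 : (e : ℤ) ∣ d := by
    by_contra h
    exact natCast_mul_omega_not_mem b hb h ((hed _).mpr (by
      exact_mod_cast intCast_mul_omega_mem b hb (dvd_refl (d : ℤ))))
  exact Nat.dvd_antisymm (Int.natCast_dvd_natCast.mp h2) (Int.natCast_dvd_natCast.mp h1)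

omit hp in
/-- `f(L𝔞_k) J = J` for an `𝒪_c`-saturated `J`: the kernel ideals fix the lattices of conductor
`c` (`𝔞_k 𝒪_c = 𝒪_c`). [cite: BertoliniDarmon1996, §2.4] -/
theorem embLattice_kerUnit_mul {c d : ℕ} [NeZero c] [NeZero d] (hpc : p ∣ c) (hd : d = c * p)
    (f : K →ₐ[ℚ] S.D) (k : ℤ) {J : Submodule ℤ S.D}
    (hJ : embLattice f (Subalgebra.toSubmodule (quadOrder K c)) * J = J) :
    embLattice f (fracIdealLattice d (kerUnit b hb hpc hd k : FractionalIdeal (quadOrder K d)⁰ K)) * J = J := by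
  have h : c ∣ d := Dvd.intro p hd.symm
  have hL : fracIdealLattice d (kerUnit b hb hpc hd k : FractionalIdeal (quadOrder K d)⁰ K) *
      Subalgebra.toSubmodule (quadOrder K c) = Subalgebra.toSubmodule (quadOrder K c) := by
    rw [← fracIdealLattice_extFrac h, ← coe_extUnits, extUnits_kerUnit, Units.val_one, fracIdealLattice_one]
  conv_lhs => rw [← hJ, ← mul_assoc, ← embLattice_mul, hL]
  exact hJ

/-- Eichler's count at an arbitrary invertible right `O`-ideal of a Brandt setup (`p ∤ N⁺N⁻`):
exactly `p + 1` invertible right sub-ideals of index `p²` (transported from the class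
representative by a unit). [cite: Eichler1973, Ch. II §6 (16)] -/
theorem ncard_subideals_eq (hpN : ¬ p ∣ Nplus * Nminus) {I : Submodule ℤ S.D}
    (hI : I ∈ Brandt.rightIdeals S.O) :
    {M : Submodule ℤ S.D | M ≤ I ∧ M.toAddSubgroup.relIndex I.toAddSubgroup = p ^ 2 ∧
        M ∈ Brandt.rightIdeals S.O}.ncard = p + 1 := by
  have hcl : ∀ M ∈ Brandt.rightIdeals S.O, ∀ β : S.Dˣ, β • M ∈ Brandt.rightIdeals S.O :=
    fun M hM β => Brandt.units_smul_mem_rightIdeals_of_isTotallyDefinite S.isTotallyDefinite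
      S.isEichlerOrder.isOrder hM β
  obtain ⟨β, hβ⟩ := Brandt.exists_rep_mk_eq_smul (⟨I, hI⟩ : Brandt.rightIdeals S.O)
  set j : Brandt.ClassSet S.O := Quotient.mk (Brandt.rightClassSetoid S.O) ⟨I, hI⟩ with hj
  have hcount := S.ncard_subideals_eq_prime_add_one hp.out hpN j
  rw [← hcount]
  change _ = Set.ncard {M : Submodule ℤ S.D | M ≤ j.rep ∧ _ ∧ _}
  rw [hβ]
  change _ = Set.ncard {M : Submodule ℤ S.D | M ≤ β • I ∧
    M.toAddSubgroup.relIndex (β • I).toAddSubgroup = p ^ 2 ∧ M ∈ Brandt.rightIdeals S.O}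
  have himg : {M : Submodule ℤ S.D | M ≤ β • I ∧
      M.toAddSubgroup.relIndex (β • I).toAddSubgroup = p ^ 2 ∧ M ∈ Brandt.rightIdeals S.O} =
      (fun M => β • M) '' {M : Submodule ℤ S.D | M ≤ I ∧
        M.toAddSubgroup.relIndex I.toAddSubgroup = p ^ 2 ∧ M ∈ Brandt.rightIdeals S.O} := by
    ext M
    constructor
    · rintro ⟨hle, hidx, hmem⟩
      refine ⟨β⁻¹ • M, ⟨?_, ?_, hcl _ hmem β⁻¹⟩, smul_inv_smul β M⟩
      · rwa [← Brandt.units_smul_le_units_smul_iff β, smul_inv_smul]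
      · rwa [← Brandt.relIndex_units_smul β, smul_inv_smul]
    · rintro ⟨M', ⟨hle, hidx, hmem⟩, rfl⟩
      exact ⟨(Brandt.units_smul_le_units_smul_iff β).mpr hle,
        (Brandt.relIndex_units_smul β M' I).trans hidx, hcl _ hmem β⟩
  rw [himg, Set.ncard_image_of_injective _ (MulAction.injective β)]

variable {e c d : ℕ} [NeZero e] [NeZero c] [NeZero d]

/-- The hypothesis shape "`Pic(𝒪_c)` preserves Heegner representatives of conductor `c`", i.e.
the statement of `GrossRep.IsHeegner.fracIdeal_mul` (BD96 §2.3: the action (4) is well defined),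
taken as an input by the lattice-level norm relation below. [cite: BertoliniDarmon1996, §2.3 (4)] -/
def HeegnerStable (S : Brandt.XiSetup Nplus Nminus) (K : Type u') [Field K] [NumberField K] : Prop :=
  ∀ (c : ℕ) [NeZero c] (𝔞 : (FractionalIdeal (quadOrder K c)⁰ K)ˣ) (f : K →ₐ[ℚ] S.D) (I : Submodule ℤ S.D),
    (⟨f, I⟩ : GrossRep S.D K).IsHeegner S.O c →
      (⟨f, embLattice f (fracIdealLattice c (𝔞 : FractionalIdeal _ K)) * I⟩ :
        GrossRep S.D K).IsHeegner S.O c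

omit hp in
/-- Central unit translates of Heegner representatives: `(f, νX)` is Heegner of conductor `d` iff
`(f, X)` is (`ν = p · 1` commutes with `f`). [folklore] -/
private theorem isHeegner_units_smul_central_iff {d : ℕ} {ν : S.Dˣ} (hν : (ν : S.D) = (p : ℤ))
    (f : K →ₐ[ℚ] S.D) (X : Submodule ℤ S.D) :
    (⟨f, ν • X⟩ : GrossRep S.D K).IsHeegner S.O d ↔ (⟨f, X⟩ : GrossRep S.D K).IsHeegner S.O d := by
  have h : (⟨f, ν • X⟩ : GrossRep S.D K) = ν • ⟨f, X⟩ := by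
    refine GrossRep.ext ?_ rfl
    ext x
    change f x = (ν : S.D) * f x * ((ν⁻¹ : S.Dˣ) : S.D)
    rw [hν, (Int.cast_commute (p : ℤ) (f x)).eq, ← hν, mul_assoc, Units.mul_inv, mul_one]
  rw [h, GrossRep.IsHeegner.units_smul_iff]

omit [NeZero d] hp in
/-- **Optimality detects ideals**: if `f(𝔲) I = f(𝔳) I` for an optimal embedding `f` of `𝒪_d` into
`O_L(I)`, then `𝔳 ⊆ 𝔲` (apply optimality to `𝔲⁻¹𝔳`, which fixes `I`). [cite: BertoliniDarmon1996, §2.3 (4)] -/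
theorem le_of_embLattice_mul_eq {f : K →ₐ[ℚ] S.D} {I : Submodule ℤ S.D}
    (hI : (⟨f, I⟩ : GrossRep S.D K).IsHeegner S.O d) (u v : (FractionalIdeal (quadOrder K d)⁰ K)ˣ)
    (huv : embLattice f (fracIdealLattice d (u : FractionalIdeal (quadOrder K d)⁰ K)) * I =
      embLattice f (fracIdealLattice d (v : FractionalIdeal (quadOrder K d)⁰ K)) * I) :
    (v : FractionalIdeal (quadOrder K d)⁰ K) ≤ u := by
  have hIsat : embLattice f (Subalgebra.toSubmodule (quadOrder K d)) * I = I := sat_of_isHeegner hI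
  have h1 : embLattice f (fracIdealLattice d ((u⁻¹ * v : (FractionalIdeal (quadOrder K d)⁰ K)ˣ) :
      FractionalIdeal (quadOrder K d)⁰ K)) * I = I := by
    rw [Units.val_mul, fracIdealLattice_mul, embLattice_mul, mul_assoc, ← huv, ← mul_assoc,
      ← embLattice_mul, ← fracIdealLattice_mul, Units.inv_mul, fracIdealLattice_one, hIsat]
  have hsub : ((u⁻¹ * v : (FractionalIdeal (quadOrder K d)⁰ K)ˣ) : FractionalIdeal (quadOrder K d)⁰ K) ≤ 1 := by
    intro y hy
    have hyO : y ∈ quadOrder K d := by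
      refine (hI.2 y).mp fun m hm => ?_
      have h2 := Submodule.mul_mem_mul (apply_mem_embLattice f ((mem_fracIdealLattice_iff).mpr hy)) hm
      rwa [h1] at h2
    exact (FractionalIdeal.mem_one_iff _).mpr ⟨⟨y, hyO⟩, rfl⟩
  have h3 := mul_le_mul_right hsub (u : FractionalIdeal (quadOrder K d)⁰ K)
  rwa [← Units.val_mul, mul_inv_cancel_left, mul_one] at h3

set_option maxHeartbeats 400000 in
include hb in
/-- **The upper neighbours** `p · f(A_k) I` of `f(A)J` (`A_k` the lattice of `𝔞_k𝔞`): Heegner of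
conductor `d`, contained in `f(A)J`, of index `p²`. [cite: BertoliniDarmon1996, §2.4 (5)] -/
theorem upper_neighbour (hHS : HeegnerStable S K) (hpc : p ∣ c) (hd : d = c * p)
    {f : K →ₐ[ℚ] S.D} {I J : Submodule ℤ S.D}
    (hI : (⟨f, I⟩ : GrossRep S.D K).IsHeegner S.O d) (hJ : (⟨f, J⟩ : GrossRep S.D K).IsHeegner S.O c)
    (hJI : J ≤ I) (hpI : (p : ℤ) • I ≤ J) (hidxJ : J.toAddSubgroup.relIndex I.toAddSubgroup = p ^ 2)
    (𝔞 : (FractionalIdeal (quadOrder K d)⁰ K)ˣ) {ν : S.Dˣ} (hν : (ν : S.D) = (p : ℤ)) (k : ℤ) :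
    (⟨f, ν • (embLattice f (fracIdealLattice d ((kerUnit b hb hpc hd (k : ℤ) * 𝔞 : (FractionalIdeal (quadOrder K d)⁰ K)ˣ) : FractionalIdeal (quadOrder K d)⁰ K)) * I)⟩ : GrossRep S.D K).IsHeegner S.O d ∧
      ν • (embLattice f (fracIdealLattice d ((kerUnit b hb hpc hd (k : ℤ) * 𝔞 : (FractionalIdeal (quadOrder K d)⁰ K)ˣ) : FractionalIdeal (quadOrder K d)⁰ K)) * I) ≤ embLattice f (fracIdealLattice d (𝔞 : FractionalIdeal (quadOrder K d)⁰ K)) * J ∧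
      (ν • (embLattice f (fracIdealLattice d ((kerUnit b hb hpc hd (k : ℤ) * 𝔞 : (FractionalIdeal (quadOrder K d)⁰ K)ˣ) : FractionalIdeal (quadOrder K d)⁰ K)) * I)).toAddSubgroup.relIndex
        (embLattice f (fracIdealLattice d (𝔞 : FractionalIdeal (quadOrder K d)⁰ K)) * J).toAddSubgroup = p ^ 2 := by
  have hcd : c ∣ d := Dvd.intro p hd.symm
  have hpd : p ∣ d := hpc.trans hcd
  have hIsat : embLattice f (Subalgebra.toSubmodule (quadOrder K d)) * I = I := sat_of_isHeegner hI
  have hJsat : embLattice f (Subalgebra.toSubmodule (quadOrder K c)) * J = J := sat_of_isHeegner hJ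
  have hJsatd : embLattice f (Subalgebra.toSubmodule (quadOrder K d)) * J = J := sat_of_dvd hcd f hJsat
  have hAkJ : embLattice f (fracIdealLattice d ((kerUnit b hb hpc hd (k : ℤ) * 𝔞 : (FractionalIdeal (quadOrder K d)⁰ K)ˣ) : FractionalIdeal (quadOrder K d)⁰ K)) * J = embLattice f (fracIdealLattice d (𝔞 : FractionalIdeal (quadOrder K d)⁰ K)) * J := by
    rw [Units.val_mul, fracIdealLattice_mul, mul_comm (fracIdealLattice d _), embLattice_mul, mul_assoc,
      embLattice_kerUnit_mul hb hpc hd f k hJsat]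
  refine ⟨(isHeegner_units_smul_central_iff hν f _).mpr (hHS d (kerUnit b hb hpc hd k * 𝔞) f I hI),
    ?_, ?_⟩
  · rw [← hAkJ, units_smul_eq_zsmul hν, zsmul_mul_eq]; exact mul_le_mul' le_rfl hpI
  · have hJpI : (ν • I).toAddSubgroup.relIndex J.toAddSubgroup = p ^ 2 := by
      have h4 := Brandt.relIndex_natCast_smul hI.1.1 hν
      have hle : ν • I ≤ J := by rw [units_smul_eq_zsmul hν]; exact hpI
      have hmul := AddSubgroup.relIndex_mul_relIndex (ν • I).toAddSubgroup J.toAddSubgroup I.toAddSubgroup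
        (fun x hx => hle hx) (fun x hx => hJI hx)
      rw [h4, hidxJ, show p ^ 4 = p ^ 2 * p ^ 2 by ring] at hmul
      exact Nat.eq_of_mul_eq_mul_right (pow_pos hp.out.pos 2) hmul
    have hpIsat : embLattice f (Subalgebra.toSubmodule (quadOrder K d)) * ((p : ℤ) • I) = (p : ℤ) • I := by
      rw [← zsmul_mul_eq, hIsat]
    have hpIle : (p : ℤ) • J ≤ (p : ℤ) • I := by
      intro x hx
      obtain ⟨y, hy, rfl⟩ := (Submodule.mem_smul_pointwise_iff_exists _ _ _).mp hx
      exact Submodule.smul_mem_pointwise_smul _ _ _ (hJI hy)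
    have h := relIndex_embLattice_mul_eq hb hpd f (kerUnit b hb hpc hd k * 𝔞) hJsatd hpIsat hpI hpIle
    rw [← hAkJ, units_smul_eq_zsmul hν, zsmul_mul_eq, h, ← units_smul_eq_zsmul hν, hJpI]

set_option maxHeartbeats 400000 in
include hb in
/-- **The lower neighbour** `f(A) J₀` of `f(A) J`: Heegner of conductor `e`, of index `p²`; and
`f(A)J` itself is Heegner of conductor `c`. [cite: BertoliniDarmon1996, §2.4 (5)] -/
theorem lower_neighbour (hHS : HeegnerStable S K) (hpc : p ∣ c) (hc : c = e * p) (hd : d = c * p)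
    {f : K →ₐ[ℚ] S.D} {J J₀ : Submodule ℤ S.D}
    (hJ : (⟨f, J⟩ : GrossRep S.D K).IsHeegner S.O c) (hJ₀ : (⟨f, J₀⟩ : GrossRep S.D K).IsHeegner S.O e)
    (hJ₀J : J₀ ≤ J) (hpJ : (p : ℤ) • J ≤ J₀)
    (hidxJ₀ : J₀.toAddSubgroup.relIndex J.toAddSubgroup = p ^ 2)
    (𝔞 : (FractionalIdeal (quadOrder K d)⁰ K)ˣ) :
    (⟨f, embLattice f (fracIdealLattice d (𝔞 : FractionalIdeal (quadOrder K d)⁰ K)) * J⟩ : GrossRep S.D K).IsHeegner S.O c ∧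
      (⟨f, embLattice f (fracIdealLattice d (𝔞 : FractionalIdeal (quadOrder K d)⁰ K)) * J₀⟩ : GrossRep S.D K).IsHeegner S.O e ∧
      (embLattice f (fracIdealLattice d (𝔞 : FractionalIdeal (quadOrder K d)⁰ K)) * J₀).toAddSubgroup.relIndex (embLattice f (fracIdealLattice d (𝔞 : FractionalIdeal (quadOrder K d)⁰ K)) * J).toAddSubgroup = p ^ 2 := by
  have hcd : c ∣ d := Dvd.intro p hd.symm
  have hec : e ∣ c := Dvd.intro p hc.symm
  have hed : e ∣ d := hec.trans hcd
  have hJsat : embLattice f (Subalgebra.toSubmodule (quadOrder K c)) * J = J := sat_of_isHeegner hJ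
  have hJ₀sat' : embLattice f (Subalgebra.toSubmodule (quadOrder K e)) * J₀ = J₀ := sat_of_isHeegner hJ₀
  have hJ₀sat : embLattice f (Subalgebra.toSubmodule (quadOrder K c)) * J₀ = J₀ := sat_of_dvd hec f hJ₀sat'
  refine ⟨?_, ?_, ?_⟩
  · have h := hHS c (extUnits K hcd 𝔞) f J hJ
    rwa [coe_extUnits, fracIdealLattice_extFrac, embLattice_mul, mul_assoc, hJsat] at h
  · have h := hHS e (extUnits K hed 𝔞) f J₀ hJ₀
    rwa [coe_extUnits, fracIdealLattice_extFrac, embLattice_mul, mul_assoc, hJ₀sat'] at h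
  · have h := relIndex_embLattice_mul_eq hb hpc f (extUnits K hcd 𝔞) hJsat hJ₀sat hJ₀J hpJ
    rw [coe_extUnits, fracIdealLattice_extFrac, embLattice_mul, mul_assoc, mul_assoc, hJsat, hJ₀sat] at h
    rw [h, hidxJ₀]

set_option maxHeartbeats 400000 in
include hb in
/-- The `p` upper neighbours are pairwise distinct (optimality + `[𝔞_k] ≠ [𝔞_{k'}]`). [cite: BertoliniDarmon1996, §2.4 (5)] -/
theorem upper_neighbour_injOn (hK : IsImaginaryQuadratic K) (hpc : p ∣ c) (hd : d = c * p)
    {f : K →ₐ[ℚ] S.D} {I : Submodule ℤ S.D} (hI : (⟨f, I⟩ : GrossRep S.D K).IsHeegner S.O d)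
    (𝔞 : (FractionalIdeal (quadOrder K d)⁰ K)ˣ) (ν : S.Dˣ) :
    Set.InjOn (fun k : ℕ => ν • (embLattice f (fracIdealLattice d ((kerUnit b hb hpc hd (k : ℤ) * 𝔞 : (FractionalIdeal (quadOrder K d)⁰ K)ˣ) : FractionalIdeal (quadOrder K d)⁰ K)) * I)) ↑(Finset.range p) := by
  intro k hk k' hk' hkk'
  have heq : embLattice f (fracIdealLattice d ((kerUnit b hb hpc hd (k : ℤ) * 𝔞 : (FractionalIdeal (quadOrder K d)⁰ K)ˣ) : FractionalIdeal (quadOrder K d)⁰ K)) * I = embLattice f (fracIdealLattice d ((kerUnit b hb hpc hd (k' : ℤ) * 𝔞 : (FractionalIdeal (quadOrder K d)⁰ K)ˣ) : FractionalIdeal (quadOrder K d)⁰ K)) * I := by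
    have h := congrArg (fun M : Submodule ℤ S.D => ν⁻¹ • M) hkk'
    simp only [inv_smul_smul] at h
    exact h
  have hequ : kerUnit b hb hpc hd k * 𝔞 = kerUnit b hb hpc hd k' * 𝔞 :=
    Units.ext (le_antisymm (le_of_embLattice_mul_eq hI _ _ heq.symm) (le_of_embLattice_mul_eq hI _ _ heq))
  exact mk_kerUnit_injOn hb hK hpc hd hk hk' (congrArg (ClassGroup.mk K) (mul_right_cancel hequ))

set_option maxHeartbeats 400000 in
include hb in
/-- **The `p + 1` neighbours of a (translated) tower point** (BD96 §2.4: "`P̄_{n+1} = P_n`" and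
the `p` conjugates of `P_{n+1}` over `K_n`). Let `(f, J₀)`, `(f, J)`, `(f, I)` be Heegner
representatives of conductors `e`, `c = ep`, `d = cp` with `pJ ⊆ J₀ ⊆ J ⊆ I`, `pI ⊆ J`,
`[J : J₀] = p²`, `[I : J] = p²`, and let `𝔞` be an invertible `𝒪_d`-ideal with lattice `A`.
Then the invertible right sub-ideals of index `p²` of `f(A)J` are exactly `f(A)J₀` and the `p`
lattices `p · f(A_k) I`, `A_k` the lattice of `𝔞_k𝔞`, `0 ≤ k < p` (and `f(A)J₀` is none of the
latter). [cite: BertoliniDarmon1996, §2.4 (5)] -/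
theorem subideals_eq (hK : IsImaginaryQuadratic K) (hHS : HeegnerStable S K) (hpN : ¬ p ∣ Nplus * Nminus)
    (hpc : p ∣ c) (hc : c = e * p) (hd : d = c * p) {f : K →ₐ[ℚ] S.D} {I J J₀ : Submodule ℤ S.D}
    (hI : (⟨f, I⟩ : GrossRep S.D K).IsHeegner S.O d) (hJ : (⟨f, J⟩ : GrossRep S.D K).IsHeegner S.O c)
    (hJ₀ : (⟨f, J₀⟩ : GrossRep S.D K).IsHeegner S.O e)
    (hJI : J ≤ I) (hpI : (p : ℤ) • I ≤ J) (hJ₀J : J₀ ≤ J) (hpJ : (p : ℤ) • J ≤ J₀)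
    (hidxJ₀ : J₀.toAddSubgroup.relIndex J.toAddSubgroup = p ^ 2)
    (hidxJ : J.toAddSubgroup.relIndex I.toAddSubgroup = p ^ 2)
    (𝔞 : (FractionalIdeal (quadOrder K d)⁰ K)ˣ) {ν : S.Dˣ} (hν : (ν : S.D) = (p : ℤ))
    [DecidableEq (Submodule ℤ S.D)] :
    {M : Submodule ℤ S.D | M ≤ embLattice f (fracIdealLattice d (𝔞 : FractionalIdeal (quadOrder K d)⁰ K)) * J ∧
        M.toAddSubgroup.relIndex (embLattice f (fracIdealLattice d (𝔞 : FractionalIdeal (quadOrder K d)⁰ K)) * J).toAddSubgroup = p ^ 2 ∧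
        M ∈ Brandt.rightIdeals S.O} =
      ↑(insert (embLattice f (fracIdealLattice d (𝔞 : FractionalIdeal (quadOrder K d)⁰ K)) * J₀)
        ((Finset.range p).image fun k : ℕ => ν • (embLattice f (fracIdealLattice d ((kerUnit b hb hpc hd (k : ℤ) * 𝔞 : (FractionalIdeal (quadOrder K d)⁰ K)ˣ) : FractionalIdeal (quadOrder K d)⁰ K)) * I))) ∧
    embLattice f (fracIdealLattice d (𝔞 : FractionalIdeal (quadOrder K d)⁰ K)) * J₀ ∉ (Finset.range p).image fun k : ℕ => ν • (embLattice f (fracIdealLattice d ((kerUnit b hb hpc hd (k : ℤ) * 𝔞 : (FractionalIdeal (quadOrder K d)⁰ K)ˣ) : FractionalIdeal (quadOrder K d)⁰ K)) * I) := by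
  obtain ⟨hĴ, hĴ₀, hidx0⟩ := lower_neighbour hb hHS hpc hc hd hJ hJ₀ hJ₀J hpJ hidxJ₀ 𝔞
  have hup := fun k : ℤ => upper_neighbour hb hHS hpc hd hI hJ hJI hpI hidxJ 𝔞 hν k
  have hinj := upper_neighbour_injOn hb hK hpc hd hI 𝔞 ν
  have hnot : embLattice f (fracIdealLattice d (𝔞 : FractionalIdeal (quadOrder K d)⁰ K)) * J₀ ∉
      (Finset.range p).image (fun k : ℕ => ν • (embLattice f (fracIdealLattice d ((kerUnit b hb hpc hd (k : ℤ) * 𝔞 : (FractionalIdeal (quadOrder K d)⁰ K)ˣ) : FractionalIdeal (quadOrder K d)⁰ K)) * I)) := by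
    intro hmem
    obtain ⟨k, -, hk⟩ := Finset.mem_image.mp hmem
    have h1 : (⟨f, embLattice f (fracIdealLattice d (𝔞 : FractionalIdeal (quadOrder K d)⁰ K)) * J₀⟩ : GrossRep S.D K).IsHeegner S.O d := by
      rw [← hk]; exact (hup k).1
    have h2 := conductor_unique hb hĴ₀ h1
    have h3 : e * 1 < e * (p * p) :=
      Nat.mul_lt_mul_of_pos_left (by nlinarith [hp.out.two_le]) (NeZero.pos e)
    rw [mul_one, ← mul_assoc, ← hc, ← hd] at h3
    exact absurd h2 h3.ne
  refine ⟨?_, hnot⟩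
  symm
  apply Set.eq_of_subset_of_ncard_le
  · intro M hM
    rw [Finset.coe_insert, Finset.coe_image, Set.mem_insert_iff, Set.mem_image] at hM
    rcases hM with rfl | ⟨k, -, rfl⟩
    · exact ⟨mul_le_mul' le_rfl hJ₀J, hidx0, hĴ₀.1⟩
    · exact ⟨(hup k).2.1, (hup k).2.2, (hup k).1.1⟩
  · rw [ncard_subideals_eq hpN hĴ.1, Set.ncard_coe_finset, Finset.card_insert_of_notMem hnot,
      Finset.card_image_of_injOn hinj, Finset.card_range]
  · haveI : IsAddTorsionFree S.D := S.isAddTorsionFree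
    exact Brandt.finite_setOf_subideal hĴ.1.1.1 hp.out.ne_zero _

end Neighbours

/-! ### §4 The Hecke eigen-equation summed over the neighbours of an arbitrary right ideal -/

section Hecke

variable {p : ℕ} [hp : Fact p.Prime] [Fintype (Brandt.ClassSet S.O)]

omit hp [Fintype (Brandt.ClassSet S.O)] in
/-- A right ideal is a unit translate of a class representative iff it lies in that class. [folklore] -/
private theorem mem_class_iff {M : Submodule ℤ S.D} (hM : M ∈ Brandt.rightIdeals S.O) (i : Brandt.ClassSet S.O) :
    (∃ α : S.Dˣ, M = α • i.rep) ↔ (Quotient.mk (Brandt.rightClassSetoid S.O) ⟨M, hM⟩ : Brandt.ClassSet S.O) = i := by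
  constructor
  · rintro ⟨α, hα⟩
    rw [← Brandt.ClassSet.mk_rep i]
    refine Quotient.sound ⟨α⁻¹, ?_⟩
    change i.rep = α⁻¹ • M
    rw [hα, inv_smul_smul]
  · intro h
    have h' : (Quotient.mk (Brandt.rightClassSetoid S.O) ⟨M, hM⟩ : Brandt.ClassSet S.O) =
        Quotient.mk (Brandt.rightClassSetoid S.O) ⟨i.rep, i.rep_mem⟩ := by rw [h, Brandt.ClassSet.mk_rep]
    obtain ⟨β, hβ⟩ := Brandt.exists_eq_smul_of_mk_eq_mk h'
    have hβ' : i.rep = β • M := hβ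
    exact ⟨β⁻¹, by rw [hβ', inv_smul_smul]⟩

omit hp in
/-- **The eigen-equation of `T(p)` at an arbitrary right ideal `Ĵ`**: if `T(p) φ = a φ` then
`Σ_{M ⊆ Ĵ, [Ĵ:M] = p², M invertible} w_[M] φ_[M] = a · w_[Ĵ] φ_[Ĵ]` (Brandt matrix entries on
arbitrary representatives, `Brandt.matrix_apply_eq_ncard`, and the weight symmetry
`w_i T_ij = w_j T_ji`, Eichler II §6 (17)). [cite: Eichler1973, Ch. II §6 Thm. 2 eq. (17)] -/
theorem sum_subideals_yValue_eq {Ĵ : Submodule ℤ S.D} (hĴ : Ĵ ∈ Brandt.rightIdeals S.O)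
    (φ : Brandt.ClassSet S.O → ℤ) (a : ℤ) (hφ : Brandt.matrix S.O p *ᵥ φ = a • φ) (f : K →ₐ[ℚ] S.D)
    (N : Finset (Submodule ℤ S.D))
    (hN : (↑N : Set (Submodule ℤ S.D)) = {M : Submodule ℤ S.D | M ≤ Ĵ ∧
      M.toAddSubgroup.relIndex Ĵ.toAddSubgroup = p ^ 2 ∧ M ∈ Brandt.rightIdeals S.O}) :
    ∑ M ∈ N, (⟨f, M⟩ : GrossRep S.D K).yValue S.O φ = a * (⟨f, Ĵ⟩ : GrossRep S.D K).yValue S.O φ := by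
  classical
  have hdiv : ∀ x : S.D, x ≠ 0 → IsUnit x := fun x hx =>
    isUnit_of_isTotallyDefinite S.D S.isTotallyDefinite hx
  have hcl : ∀ M ∈ Brandt.rightIdeals S.O, ∀ β : S.Dˣ, β • M ∈ Brandt.rightIdeals S.O :=
    fun M hM β => Brandt.units_smul_mem_rightIdeals_of_isTotallyDefinite S.isTotallyDefinite
      S.isEichlerOrder.isOrder hM β
  set j : Brandt.ClassSet S.O := Quotient.mk (Brandt.rightClassSetoid S.O) ⟨Ĵ, hĴ⟩ with hj
  let B : Brandt.ClassSet S.O → Set (Submodule ℤ S.D) := fun i => {M | ∃ α : S.Dˣ, M = α • i.rep}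
  let c : Brandt.ClassSet S.O → ℤ := fun i => (Brandt.weight S.O i : ℤ) * φ i
  -- (a) the value at `M ∈ N` as a sum over classes
  have hval : ∀ M ∈ N, (⟨f, M⟩ : GrossRep S.D K).yValue S.O φ = ∑ i, if M ∈ B i then c i else 0 := by
    intro M hMN
    have hM : M ∈ Brandt.rightIdeals S.O := by
      have : M ∈ (↑N : Set (Submodule ℤ S.D)) := hMN
      rw [hN] at this
      exact this.2.2
    set i₀ : Brandt.ClassSet S.O := Quotient.mk (Brandt.rightClassSetoid S.O) ⟨M, hM⟩ with hi₀
    have hBi : ∀ i, M ∈ B i ↔ i = i₀ := fun i => by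
      rw [hi₀, eq_comm]; exact mem_class_iff hM i
    rw [GrossRep.yValue_eq φ (show (⟨f, M⟩ : GrossRep S.D K).lat ∈ Brandt.rightIdeals S.O from hM)]
    simp_rw [hBi]
    rw [Finset.sum_ite_eq' Finset.univ i₀, if_pos (Finset.mem_univ _)]
  -- (b) the number of `M ∈ N` in class `i` is `T(p)_{ij}`
  have hcard : ∀ i, ((N.filter fun M => M ∈ B i).card : ℤ) = Brandt.matrix S.O p i j := by
    intro i
    have hm := Brandt.matrix_apply_eq_ncard S.O p ⟨i.rep, i.rep_mem⟩ ⟨Ĵ, hĴ⟩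
    rw [Brandt.ClassSet.mk_rep, ← hj] at hm
    rw [hm, ← Set.ncard_coe_finset]
    congr 1
    congr 1
    ext M
    rw [Finset.coe_filter, Set.mem_setOf_eq, Set.mem_setOf_eq, ← Finset.mem_coe, hN, Set.mem_setOf_eq]
    constructor
    · rintro ⟨⟨hle, hidx, -⟩, hB⟩; exact ⟨hle, hidx, hB⟩
    · rintro ⟨hle, hidx, α, rfl⟩; exact ⟨⟨hle, hidx, hcl _ i.rep_mem α⟩, α, rfl⟩
  -- (c) assemble
  calc ∑ M ∈ N, (⟨f, M⟩ : GrossRep S.D K).yValue S.O φ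
      = ∑ M ∈ N, ∑ i, (if M ∈ B i then c i else 0) := Finset.sum_congr rfl hval
    _ = ∑ i, ∑ M ∈ N, (if M ∈ B i then c i else 0) := Finset.sum_comm
    _ = ∑ i, Brandt.matrix S.O p i j * c i := by
        refine Finset.sum_congr rfl fun i _ => ?_
        rw [← Finset.sum_filter, Finset.sum_const, nsmul_eq_mul, hcard]
    _ = ∑ i, (Brandt.weight S.O j : ℤ) * (Brandt.matrix S.O p j i * φ i) := by
        refine Finset.sum_congr rfl fun i _ => ?_
        have hw := Brandt.weight_mul_matrix_symm hdiv S.isEichlerOrder.isOrder p i j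
        simp only [c]
        linear_combination (φ i) * hw
    _ = (Brandt.weight S.O j : ℤ) * ((Brandt.matrix S.O p *ᵥ φ) j) := by
        rw [Matrix.mulVec, dotProduct, Finset.mul_sum]
    _ = a * (⟨f, Ĵ⟩ : GrossRep S.D K).yValue S.O φ := by
        rw [hφ, Pi.smul_apply, smul_eq_mul,
          GrossRep.yValue_eq φ (show (⟨f, Ĵ⟩ : GrossRep S.D K).lat ∈ Brandt.rightIdeals S.O from hĴ)]
        ring

end Hecke

/-! ### §5 The norm relation -/

section NormRelation

variable {b : Basis (Fin 2) ℤ (𝓞 K)} (hb : b 0 = 1) {p : ℕ} [hp : Fact p.Prime]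
  {e c d : ℕ} [NeZero e] [NeZero c] [NeZero d]

omit hp in
/-- `(f, νX) = ν • (f, X)` for the central unit `ν`. [folklore] -/
private theorem eq_central_smul {ν : S.Dˣ} (hν : (ν : S.D) = (p : ℤ)) (f : K →ₐ[ℚ] S.D)
    (X : Submodule ℤ S.D) : (⟨f, ν • X⟩ : GrossRep S.D K) = ν • ⟨f, X⟩ := by
  refine GrossRep.ext ?_ rfl
  ext x
  change f x = (ν : S.D) * f x * ((ν⁻¹ : S.Dˣ) : S.D)
  rw [hν, (Int.cast_commute (p : ℤ) (f x)).eq, ← hν, mul_assoc, Units.mul_inv, mul_one]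

include hb in
/-- **Norm relation, lattice form** (BD96 §2.4 (5): `u⁻¹ Norm_{K_{n+1}/K_n} P_{n+1} = T_p P_n − P_{n−1}`,
paired with an eigenvector `φ`, `T_p φ = a φ`, so that `Σ_k y(σ_k P_{n+1}) = a y(P_n) − y(P_{n-1})`):
with the notation of `subideals_eq`,
`Σ_{k<p} y(f, f(A_k) I) + y(f, f(A) J₀) = a · y(f, f(A) J)`. [cite: BertoliniDarmon1996, §2.4 (5)] -/
theorem norm_relation_lattice [Fintype (Brandt.ClassSet S.O)] (hK : IsImaginaryQuadratic K) (hHS : HeegnerStable S K)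
    (hpN : ¬ p ∣ Nplus * Nminus) (hpc : p ∣ c) (hc : c = e * p) (hd : d = c * p)
    {f : K →ₐ[ℚ] S.D} {I J J₀ : Submodule ℤ S.D}
    (hI : (⟨f, I⟩ : GrossRep S.D K).IsHeegner S.O d) (hJ : (⟨f, J⟩ : GrossRep S.D K).IsHeegner S.O c)
    (hJ₀ : (⟨f, J₀⟩ : GrossRep S.D K).IsHeegner S.O e)
    (hJI : J ≤ I) (hpI : (p : ℤ) • I ≤ J) (hJ₀J : J₀ ≤ J) (hpJ : (p : ℤ) • J ≤ J₀)
    (hidxJ₀ : J₀.toAddSubgroup.relIndex J.toAddSubgroup = p ^ 2)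
    (hidxJ : J.toAddSubgroup.relIndex I.toAddSubgroup = p ^ 2)
    (𝔞 : (FractionalIdeal (quadOrder K d)⁰ K)ˣ)
    (φ : Brandt.ClassSet S.O → ℤ) (a : ℤ) (hφ : Brandt.matrix S.O p *ᵥ φ = a • φ) :
    ∑ k ∈ Finset.range p, (⟨f, embLattice f (fracIdealLattice d ((kerUnit b hb hpc hd (k : ℤ) * 𝔞 : (FractionalIdeal (quadOrder K d)⁰ K)ˣ) : FractionalIdeal (quadOrder K d)⁰ K)) * I⟩ : GrossRep S.D K).yValue S.O φ +
        (⟨f, embLattice f (fracIdealLattice d (𝔞 : FractionalIdeal (quadOrder K d)⁰ K)) * J₀⟩ : GrossRep S.D K).yValue S.O φ =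
      a * (⟨f, embLattice f (fracIdealLattice d (𝔞 : FractionalIdeal (quadOrder K d)⁰ K)) * J⟩ : GrossRep S.D K).yValue S.O φ := by
  classical
  obtain ⟨ν, hν, -⟩ := Brandt.exists_units_val_eq_natCast (D := S.D) hp.out.ne_zero
  obtain ⟨hset, hnot⟩ := subideals_eq hb hK hHS hpN hpc hc hd hI hJ hJ₀ hJI hpI hJ₀J hpJ hidxJ₀ hidxJ 𝔞 hν
  have hinj := upper_neighbour_injOn hb hK hpc hd hI 𝔞 ν
  have hĴ := (lower_neighbour hb hHS hpc hc hd hJ hJ₀ hJ₀J hpJ hidxJ₀ 𝔞).1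
  have hsum := sum_subideals_yValue_eq (K := K) hĴ.1 φ a hφ f _ hset.symm
  rw [Finset.sum_insert hnot, Finset.sum_image hinj] at hsum
  rw [← hsum, add_comm]
  congr 1
  refine Finset.sum_congr rfl fun k _ => ?_
  rw [eq_central_smul hν, GrossRep.yValue_units_smul]

include hb in
/-- **Norm relation along the fibres of `Pic(𝒪_{cp}) → Pic(𝒪_c)`** (BD96 §2.4 (5) summed against
an eigenvector `φ` of `T(p)` with eigenvalue `a`): for Gross points `x_d, x_c, x_e` of conductors
`d = cp`, `c = ep`, `e` with `x_c` a `p`-neighbour of `x_d` and `x_e` a `p`-neighbour of `x_c`,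
and any `σ₀ ∈ Pic(𝒪_d)` with images `τ ∈ Pic(𝒪_c)`, `τ̄ ∈ Pic(𝒪_e)`,
`Σ_{res σ = τ} ⟨σ x_d, φ⟩ = a ⟨τ x_c, φ⟩ − ⟨τ̄ x_e, φ⟩`. [cite: BertoliniDarmon1996, §2.4 (5)] -/
theorem norm_relation [Fintype (Brandt.ClassSet S.O)] (hK : IsImaginaryQuadratic K) (hHS : HeegnerStable S K)
    (hpN : ¬ p ∣ Nplus * Nminus) (hpc : p ∣ c) (hc : c = e * p) (hd : d = c * p)
    (φ : Brandt.ClassSet S.O → ℤ) (a : ℤ) (hφ : Brandt.matrix S.O p *ᵥ φ = a • φ)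
    {xd xc xe : GrossSpace S.D K} (hxd : xd ∈ grossPoints K S d) (hxc : xc ∈ grossPoints K S c)
    (hxe : xe ∈ grossPoints K S e) (h1 : xd.IsPNeighbour p xc) (h2 : xc.IsPNeighbour p xe)
    [Fintype (ClassGroup (quadOrder K d))] [DecidableEq (ClassGroup (quadOrder K c))]
    (σ₀ : ClassGroup (quadOrder K d)) :
    ∑ σ ∈ Finset.univ.filter (fun σ => picRes K (Dvd.intro p hd.symm) σ = picRes K (Dvd.intro p hd.symm) σ₀),
        (σ • xd).yValue S φ =
      a * ((picRes K (Dvd.intro p hd.symm) σ₀) • xc).yValue S φ -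
        ((picRes K (Dvd.intro p hc.symm) (picRes K (Dvd.intro p hd.symm) σ₀)) • xe).yValue S φ := by
  classical
  have hcd : c ∣ d := Dvd.intro p hd.symm
  have hec : e ∣ c := Dvd.intro p hc.symm
  have hO : IsZOrder S.O := isZOrder_iff_isOrder.mpr S.isEichlerOrder.isOrder
  have hdiv : ∀ x : S.D, x ≠ 0 → IsUnit x := fun x hx =>
    isUnit_of_isTotallyDefinite S.D S.isTotallyDefinite hx
  have hri : ∀ {M : Submodule ℤ S.D}, M ∈ Brandt.rightIdeals S.O → IsInvertibleRightIdeal S.O M :=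
    fun hM => isInvertibleRightIdeal_of_mem_rightIdeals hM
  -- representatives with a common embedding `f`: `J₀ ⊆ J ⊆ I`
  obtain ⟨f, I, J, hfI, hfJ, hJI, hidxJ⟩ := h1
  obtain ⟨f₂, I₂, J₂, hfI₂, hfJ₂, hJ₂I₂, hidx₂⟩ := h2
  obtain ⟨β, hβ⟩ := GrossSpace.mk_eq_mk_iff.mp (hfI₂.trans hfJ.symm)
  -- `β • (f, J) = (f₂, I₂)`
  have hf₂ : f₂ = (unitConj β).comp f := (congrArg GrossRep.emb hβ).symm
  have hI₂ : I₂ = β • J := (congrArg GrossRep.lat hβ).symm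
  set J₀ : Submodule ℤ S.D := β⁻¹ • J₂ with hJ₀def
  have hfJ₀ : GrossSpace.mk (⟨f, J₀⟩ : GrossRep S.D K) = xe := by
    rw [← hfJ₂, ← GrossSpace.mk_units_smul β⁻¹ (⟨f₂, J₂⟩ : GrossRep S.D K)]
    congr 1
    refine GrossRep.ext ?_ rfl
    change f = (unitConj β⁻¹).comp f₂
    rw [hf₂, ← AlgHom.comp_assoc, ← unitConj_mul, inv_mul_cancel, unitConj_one, AlgHom.id_comp]
  have hJ₀J : J₀ ≤ J := by
    rw [hJ₀def, ← Brandt.units_smul_le_units_smul_iff β, smul_inv_smul, ← hI₂]; exact hJ₂I₂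
  have hidxJ₀ : J₀.toAddSubgroup.relIndex J.toAddSubgroup = p ^ 2 := by
    rw [hJ₀def, ← Brandt.relIndex_units_smul β, smul_inv_smul, ← hI₂]; exact hidx₂
  -- Heegner conditions
  have hI : (⟨f, I⟩ : GrossRep S.D K).IsHeegner S.O d := mk_mem_grossPoints_iff.mp (hfI ▸ hxd)
  have hJ : (⟨f, J⟩ : GrossRep S.D K).IsHeegner S.O c := mk_mem_grossPoints_iff.mp (hfJ ▸ hxc)
  have hJ₀ : (⟨f, J₀⟩ : GrossRep S.D K).IsHeegner S.O e := mk_mem_grossPoints_iff.mp (hfJ₀ ▸ hxe)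
  -- `p I ⊆ J`, `p J ⊆ J₀`
  have hpI : (p : ℤ) • I ≤ J :=
    (hri hJ.1).natCast_smul_le_of_relIndex_eq_sq hdiv hO (hri hI.1) hJI hidxJ
  have hpJ : (p : ℤ) • J ≤ J₀ :=
    (hri hJ₀.1).natCast_smul_le_of_relIndex_eq_sq hdiv hO (hri hJ.1) hJ₀J hidxJ₀
  -- `σ₀ = [𝔞]`
  obtain ⟨𝔞, rfl⟩ : ∃ 𝔞 : (FractionalIdeal (quadOrder K d)⁰ K)ˣ, ClassGroup.mk K 𝔞 = σ₀ :=
    ClassGroup.induction (K := K) (P := fun σ => ∃ 𝔞 : (FractionalIdeal (quadOrder K d)⁰ K)ˣ,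
      ClassGroup.mk K 𝔞 = σ) (fun 𝔞 => ⟨𝔞, rfl⟩) σ₀
  have hsatd : GrossSpace.IsSaturated d (GrossSpace.mk (⟨f, I⟩ : GrossRep S.D K)) :=
    GrossSpace.isSaturated_of_mem_grossPoints (hfI ▸ hxd)
  have hsatc : GrossSpace.IsSaturated c (GrossSpace.mk (⟨f, J⟩ : GrossRep S.D K)) :=
    GrossSpace.isSaturated_of_mem_grossPoints (hfJ ▸ hxc)
  have hsate : GrossSpace.IsSaturated e (GrossSpace.mk (⟨f, J₀⟩ : GrossRep S.D K)) :=
    GrossSpace.isSaturated_of_mem_grossPoints (hfJ₀ ▸ hxe)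
  have hJsat : embLattice f (Subalgebra.toSubmodule (quadOrder K c)) * J = J := sat_of_isHeegner hJ
  have hJ₀sat' : embLattice f (Subalgebra.toSubmodule (quadOrder K e)) * J₀ = J₀ := sat_of_isHeegner hJ₀
  have hJ₀sat : embLattice f (Subalgebra.toSubmodule (quadOrder K c)) * J₀ = J₀ := sat_of_dvd hec f hJ₀sat'
  -- the three translated points
  have hxc' : (picRes K hcd (ClassGroup.mk K 𝔞)) • xc =
      GrossSpace.mk ⟨f, embLattice f (fracIdealLattice d (𝔞 : FractionalIdeal (quadOrder K d)⁰ K)) * J⟩ := by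
    rw [picRes_mk, ← hfJ, GrossSpace.picard_mk_smul_mk c _ _ hsatc, coe_extUnits, fracIdealLattice_extFrac,
      embLattice_mul, mul_assoc, hJsat]
  have hxe' : (picRes K hec (picRes K hcd (ClassGroup.mk K 𝔞))) • xe =
      GrossSpace.mk ⟨f, embLattice f (fracIdealLattice d (𝔞 : FractionalIdeal (quadOrder K d)⁰ K)) * J₀⟩ := by
    rw [picRes_mk, picRes_mk, ← hfJ₀, GrossSpace.picard_mk_smul_mk e _ _ hsate, coe_extUnits,
      fracIdealLattice_extFrac, coe_extUnits, fracIdealLattice_extFrac, embLattice_mul, embLattice_mul,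
      mul_assoc, mul_assoc, hJ₀sat', hJ₀sat]
  have hxd' : ∀ k : ℕ, (ClassGroup.mk K (kerUnit b hb hpc hd (k : ℤ)) * ClassGroup.mk K 𝔞) • xd =
      GrossSpace.mk ⟨f, embLattice f (fracIdealLattice d ((kerUnit b hb hpc hd (k : ℤ) * 𝔞 : (FractionalIdeal (quadOrder K d)⁰ K)ˣ) : FractionalIdeal (quadOrder K d)⁰ K)) * I⟩ := fun k => by
    rw [← map_mul, ← hfI, GrossSpace.picard_mk_smul_mk d _ _ hsatd]
  rw [sum_filter_picRes_eq_sum_range hb hK hpc hd (ClassGroup.mk K 𝔞) (fun σ => (σ • xd).yValue S φ),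
    hxc', hxe', GrossSpace.yValue_mk, GrossSpace.yValue_mk]
  simp_rw [hxd', GrossSpace.yValue_mk]
  exact eq_sub_of_add_eq (norm_relation_lattice hb hK hHS hpN hpc hc hd hI hJ hJ₀ hJI hpI hJ₀J hpJ
    hidxJ₀ hidxJ 𝔞 φ a hφ)

end NormRelation

end GrossPointTowerNorm

end Literature.NumberTheory.EllipticCurves



namespace Literature.NumberTheory.EllipticCurves

namespace NormCompatAux

/-! ### Private copy of the toolkit of `GrossPointsPicardActionHeegner` (BD96 §2.3 (4) "well
defined"), whose compiled module is not importable on this hub at the time of writing; the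
statements and proofs are verbatim, kept private. -/

open scoped Pointwise nonZeroDivisors
open NumberField Literature.NumberTheory.Automorphic

universe uK vD

variable {D : Type vD} [Ring D] [Algebra ℚ D] {K : Type uK} [Field K] [NumberField K]

/-! ### Submodule-product toolkit -/

section Toolkit

variable {B : Type vD} [Ring B]

/-- `X ⊆ O_L(Y) ↔ X Y ⊆ Y`. [folklore] -/
private theorem le_leftOrder_iff_mul_le {X Y : Submodule ℤ B} : X ≤ Brandt.leftOrder Y ↔ X * Y ≤ Y := by
  rw [Submodule.mul_le]
  exact ⟨fun h x hx y hy => h hx y hy, fun h x hx y hy => h x hx y hy⟩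

/-- `X ⊆ O_R(Y) ↔ Y X ⊆ Y`. [folklore] -/
private theorem le_rightOrder_iff_mul_le {X Y : Submodule ℤ B} : X ≤ Brandt.rightOrder Y ↔ Y * X ≤ Y := by
  rw [Submodule.mul_le]
  exact ⟨fun h y hy x hx => h hx y hy, fun h x hx y hy => h y hy x hx⟩

/-- `y ∈ O_L(Y) ↔ (ℤ y) Y ⊆ Y`. [folklore] -/
private theorem mem_leftOrder_iff_span_mul_le {Y : Submodule ℤ B} {y : B} :
    y ∈ Brandt.leftOrder Y ↔ (ℤ ∙ y) * Y ≤ Y := by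
  rw [← le_leftOrder_iff_mul_le, Submodule.span_singleton_le_iff_mem]

/-- `y ∈ O_R(Y) ↔ Y (ℤ y) ⊆ Y`. [folklore] -/
private theorem mem_rightOrder_iff_mul_span_le {Y : Submodule ℤ B} {y : B} :
    y ∈ Brandt.rightOrder Y ↔ Y * (ℤ ∙ y) ≤ Y := by
  rw [← le_rightOrder_iff_mul_le, Submodule.span_singleton_le_iff_mem]

/-- `O_L(Y) O_L(Y) ⊆ O_L(Y)`. [folklore] -/
private theorem leftOrder_mul_leftOrder_le (Y : Submodule ℤ B) :
    Brandt.leftOrder Y * Brandt.leftOrder Y ≤ Brandt.leftOrder Y :=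
  Submodule.mul_le.mpr fun _ ha _ hb => Brandt.mul_mem_leftOrder ha hb

end Toolkit

section GrossRepCopy

open GrossRep GrossSpace

variable (f : K →ₐ[ℚ] D)

/-- Images of lattices of `K` commute: `f(𝔞) f(𝔟) = f(𝔟) f(𝔞)` (`K` is commutative). [folklore] -/
private theorem embLattice_mul_comm (𝔞 𝔟 : Submodule ℤ K) :
    embLattice f 𝔞 * embLattice f 𝔟 = embLattice f 𝔟 * embLattice f 𝔞 := by
  rw [← embLattice_mul, mul_comm, embLattice_mul]

/-- `f(ℤ x) = ℤ f(x)`. [folklore] -/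
private theorem embLattice_span_singleton (x : K) : embLattice f (ℤ ∙ x) = ℤ ∙ f x := by
  rw [embLattice, Submodule.map_span, Set.image_singleton]
  rfl

/-- `ℤ f(x)` commutes with every `f(𝔟)`. [folklore] -/
private theorem span_singleton_mul_embLattice_comm (x : K) (𝔟 : Submodule ℤ K) :
    (ℤ ∙ f x) * embLattice f 𝔟 = embLattice f 𝔟 * (ℤ ∙ f x) := by
  rw [← embLattice_span_singleton, embLattice_mul_comm]

/-- `1 ∈ f(𝒪_c)`. [folklore] -/
private theorem one_mem_embLattice_quadOrder (c : ℕ) :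
    (1 : D) ∈ embLattice f (Subalgebra.toSubmodule (quadOrder K c)) := by
  have h : f 1 ∈ embLattice f (Subalgebra.toSubmodule (quadOrder K c)) :=
    apply_mem_embLattice f (Subalgebra.one_mem (quadOrder K c))
  simpa using h

variable {f}

section FracIdeal

variable {c : ℕ} (𝔞 : (FractionalIdeal (quadOrder K c)⁰ K)ˣ)

/-- `f(𝔞) f(𝔞⁻¹) = f(𝒪_c)`. [folklore] -/
private theorem embLattice_fracIdeal_mul_inv :
    embLattice f (fracIdealLattice c (𝔞 : FractionalIdeal _ K)) *
      embLattice f (fracIdealLattice c ((𝔞⁻¹ : (FractionalIdeal (quadOrder K c)⁰ K)ˣ) :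
        FractionalIdeal _ K)) =
      embLattice f (Subalgebra.toSubmodule (quadOrder K c)) := by
  rw [← embLattice_mul, ← fracIdealLattice_mul, Units.mul_inv, fracIdealLattice_one]

/-- `f(𝔞⁻¹) f(𝔞) = f(𝒪_c)`. [folklore] -/
private theorem embLattice_fracIdeal_inv_mul :
    embLattice f (fracIdealLattice c ((𝔞⁻¹ : (FractionalIdeal (quadOrder K c)⁰ K)ˣ) :
        FractionalIdeal _ K)) *
      embLattice f (fracIdealLattice c (𝔞 : FractionalIdeal _ K)) =
      embLattice f (Subalgebra.toSubmodule (quadOrder K c)) := by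
  rw [← embLattice_mul, ← fracIdealLattice_mul, Units.inv_mul, fracIdealLattice_one]

end FracIdeal

variable {c : ℕ} {r : GrossRep D K}

/-- `f(𝒪_c) ⊆ O_L(I)` gives `f(𝒪_c) I = I`. [folklore] -/
private theorem embLattice_quadOrder_mul_eq
    (h : ∀ x : K, x ∈ quadOrder K c → r.emb x ∈ Brandt.leftOrder r.lat) :
    embLattice r.emb (Subalgebra.toSubmodule (quadOrder K c)) * r.lat = r.lat := by
  refine le_antisymm ?_ fun m hm => ?_
  · rw [Submodule.mul_le]
    rintro _ ⟨a, ha, rfl⟩ m hm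
    exact h a ha m hm
  · simpa using Submodule.mul_mem_mul (one_mem_embLattice_quadOrder r.emb c) hm

/-- `f(𝒪_c) ⊆ O_L(I)`, as lattices. [folklore] -/
private theorem embLattice_quadOrder_le_leftOrder
    (h : ∀ x : K, x ∈ quadOrder K c → r.emb x ∈ Brandt.leftOrder r.lat) :
    embLattice r.emb (Subalgebra.toSubmodule (quadOrder K c)) ≤ Brandt.leftOrder r.lat := by
  rintro _ ⟨a, ha, rfl⟩; exact h a ha

variable (𝔞 : (FractionalIdeal (quadOrder K c)⁰ K)ˣ)

/-- **`O_L(f(𝔞) I) = f(𝔞) O_L(I) f(𝔞⁻¹)`** for a pair `(f, I)` with `f(𝒪_c) ⊆ O_L(I)` and an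
invertible fractional `𝒪_c`-ideal `𝔞`. (`⊇`: `(A L A')(A I) = A L (A'A) I = A L I = A I`; `⊆`: if
`y A I ⊆ A I` then `A' y A I ⊆ I`, so `A' y A ⊆ L` and `y ∈ (A A') y (A A') ⊆ A L A'`.) [folklore] -/
private theorem leftOrder_embLattice_mul
    (h : ∀ x : K, x ∈ quadOrder K c → r.emb x ∈ Brandt.leftOrder r.lat) :
    Brandt.leftOrder (embLattice r.emb (fracIdealLattice c (𝔞 : FractionalIdeal _ K)) * r.lat) =
      embLattice r.emb (fracIdealLattice c (𝔞 : FractionalIdeal _ K)) * Brandt.leftOrder r.lat *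
        embLattice r.emb (fracIdealLattice c ((𝔞⁻¹ : (FractionalIdeal (quadOrder K c)⁰ K)ˣ) :
          FractionalIdeal _ K)) := by
  have hAA' := embLattice_fracIdeal_mul_inv (f := r.emb) 𝔞
  have hA'A := embLattice_fracIdeal_inv_mul (f := r.emb) 𝔞
  have hO'I := embLattice_quadOrder_mul_eq h
  have h1O' := one_mem_embLattice_quadOrder r.emb c
  apply le_antisymm
  · intro y hy
    have hy' := mem_leftOrder_iff_span_mul_le.mp hy
    -- `A' (ℤ y) A ⊆ L`
    have hZ : embLattice r.emb (fracIdealLattice c ((𝔞⁻¹ : (FractionalIdeal (quadOrder K c)⁰ K)ˣ) :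
          FractionalIdeal _ K)) * (ℤ ∙ y) *
        embLattice r.emb (fracIdealLattice c (𝔞 : FractionalIdeal _ K)) ≤ Brandt.leftOrder r.lat := by
      rw [le_leftOrder_iff_mul_le]
      calc _ = embLattice r.emb (fracIdealLattice c ((𝔞⁻¹ : (FractionalIdeal (quadOrder K c)⁰ K)ˣ) :
              FractionalIdeal _ K)) * ((ℤ ∙ y) *
              (embLattice r.emb (fracIdealLattice c (𝔞 : FractionalIdeal _ K)) * r.lat)) := by
            simp only [mul_assoc]
        _ ≤ embLattice r.emb (fracIdealLattice c ((𝔞⁻¹ : (FractionalIdeal (quadOrder K c)⁰ K)ˣ) :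
              FractionalIdeal _ K)) *
              (embLattice r.emb (fracIdealLattice c (𝔞 : FractionalIdeal _ K)) * r.lat) :=
            mul_le_mul_right hy' _
        _ = r.lat := by rw [← mul_assoc, hA'A, hO'I]
    -- `y ∈ O' (ℤ y) O' = A (A' (ℤ y) A) A' ⊆ A L A'`
    have hy1 : y ∈ embLattice r.emb (Subalgebra.toSubmodule (quadOrder K c)) * (ℤ ∙ y) *
        embLattice r.emb (Subalgebra.toSubmodule (quadOrder K c)) := by
      have : (ℤ ∙ y) ≤ embLattice r.emb (Subalgebra.toSubmodule (quadOrder K c)) * (ℤ ∙ y) *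
          embLattice r.emb (Subalgebra.toSubmodule (quadOrder K c)) :=
        calc (ℤ ∙ y) = 1 * (ℤ ∙ y) * 1 := by rw [one_mul, mul_one]
          _ ≤ _ := mul_le_mul' (mul_le_mul' (Submodule.one_le.mpr h1O') le_rfl)
              (Submodule.one_le.mpr h1O')
      exact this (Submodule.mem_span_singleton_self y)
    rw [← hAA'] at hy1
    have : embLattice r.emb (fracIdealLattice c (𝔞 : FractionalIdeal _ K)) *
        embLattice r.emb (fracIdealLattice c ((𝔞⁻¹ : (FractionalIdeal (quadOrder K c)⁰ K)ˣ) :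
          FractionalIdeal _ K)) * (ℤ ∙ y) *
        (embLattice r.emb (fracIdealLattice c (𝔞 : FractionalIdeal _ K)) *
          embLattice r.emb (fracIdealLattice c ((𝔞⁻¹ : (FractionalIdeal (quadOrder K c)⁰ K)ˣ) :
            FractionalIdeal _ K))) ≤ _ :=
      calc _ = embLattice r.emb (fracIdealLattice c (𝔞 : FractionalIdeal _ K)) *
            (embLattice r.emb (fracIdealLattice c ((𝔞⁻¹ : (FractionalIdeal (quadOrder K c)⁰ K)ˣ) :
              FractionalIdeal _ K)) * (ℤ ∙ y) *
              embLattice r.emb (fracIdealLattice c (𝔞 : FractionalIdeal _ K))) *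
            embLattice r.emb (fracIdealLattice c ((𝔞⁻¹ : (FractionalIdeal (quadOrder K c)⁰ K)ˣ) :
              FractionalIdeal _ K)) := by simp only [mul_assoc]
        _ ≤ embLattice r.emb (fracIdealLattice c (𝔞 : FractionalIdeal _ K)) * Brandt.leftOrder r.lat *
            embLattice r.emb (fracIdealLattice c ((𝔞⁻¹ : (FractionalIdeal (quadOrder K c)⁰ K)ˣ) :
              FractionalIdeal _ K)) := mul_le_mul' (mul_le_mul_right hZ _) le_rfl
    exact this hy1
  · rw [le_leftOrder_iff_mul_le]
    calc _ = embLattice r.emb (fracIdealLattice c (𝔞 : FractionalIdeal _ K)) * (Brandt.leftOrder r.lat *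
          ((embLattice r.emb (fracIdealLattice c ((𝔞⁻¹ : (FractionalIdeal (quadOrder K c)⁰ K)ˣ) :
            FractionalIdeal _ K)) * embLattice r.emb (fracIdealLattice c (𝔞 : FractionalIdeal _ K))) *
            r.lat)) := by simp only [mul_assoc]
      _ = embLattice r.emb (fracIdealLattice c (𝔞 : FractionalIdeal _ K)) * r.lat := by
          rw [hA'A, hO'I, Brandt.leftOrder_mul_self]
      _ ≤ _ := le_rfl

/-- **`O_R(f(𝔞) I) = O_R(I)`** under the same hypotheses. [folklore] -/
private theorem rightOrder_embLattice_mul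
    (h : ∀ x : K, x ∈ quadOrder K c → r.emb x ∈ Brandt.leftOrder r.lat) :
    Brandt.rightOrder (embLattice r.emb (fracIdealLattice c (𝔞 : FractionalIdeal _ K)) * r.lat) =
      Brandt.rightOrder r.lat := by
  refine le_antisymm (fun y hy => ?_) (Brandt.rightOrder_le_rightOrder_mul _ _)
  rw [mem_rightOrder_iff_mul_span_le] at hy ⊢
  have key := mul_le_mul_right hy
    (embLattice r.emb (fracIdealLattice c ((𝔞⁻¹ : (FractionalIdeal (quadOrder K c)⁰ K)ˣ) :
      FractionalIdeal _ K)))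
  simp only [← mul_assoc, embLattice_fracIdeal_inv_mul, embLattice_quadOrder_mul_eq h] at key
  exact key

/-- **Optimality is preserved**: `f x ∈ O_L(f(𝔞) I) ↔ f x ∈ O_L(I)` (so `f` is an optimal
embedding of `𝒪_c` into `O_L(f(𝔞) I)` iff it is one into `O_L(I)`). (`←`: `f x ∈ O' ⊆ A L A'`;
`→`: `(ℤ f x) O' = A' (ℤ f x) A ⊆ O' L O' ⊆ L` by commutativity.) [folklore] -/
private theorem apply_mem_leftOrder_embLattice_mul_iff
    (h : ∀ x : K, x ∈ quadOrder K c → r.emb x ∈ Brandt.leftOrder r.lat) (x : K) :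
    r.emb x ∈ Brandt.leftOrder (embLattice r.emb (fracIdealLattice c (𝔞 : FractionalIdeal _ K)) * r.lat) ↔
      r.emb x ∈ Brandt.leftOrder r.lat := by
  have hA'A := embLattice_fracIdeal_inv_mul (f := r.emb) 𝔞
  have hAA' := embLattice_fracIdeal_mul_inv (f := r.emb) 𝔞
  have hO'L := embLattice_quadOrder_le_leftOrder h
  have h1O' := one_mem_embLattice_quadOrder r.emb c
  rw [leftOrder_embLattice_mul 𝔞 h]
  constructor
  · intro hx
    have hx' : (ℤ ∙ r.emb x) ≤ _ := (Submodule.span_singleton_le_iff_mem _ _).mpr hx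
    have e1 : embLattice r.emb (fracIdealLattice c ((𝔞⁻¹ : (FractionalIdeal (quadOrder K c)⁰ K)ˣ) :
          FractionalIdeal _ K)) * (ℤ ∙ r.emb x) *
        embLattice r.emb (fracIdealLattice c (𝔞 : FractionalIdeal _ K)) =
        (ℤ ∙ r.emb x) * embLattice r.emb (Subalgebra.toSubmodule (quadOrder K c)) := by
      rw [mul_assoc, span_singleton_mul_embLattice_comm, ← mul_assoc, hA'A,
        ← span_singleton_mul_embLattice_comm]
    have hZ : (ℤ ∙ r.emb x) * embLattice r.emb (Subalgebra.toSubmodule (quadOrder K c)) ≤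
        Brandt.leftOrder r.lat :=
      calc _ = _ := e1.symm
        _ ≤ embLattice r.emb (fracIdealLattice c ((𝔞⁻¹ : (FractionalIdeal (quadOrder K c)⁰ K)ˣ) :
              FractionalIdeal _ K)) *
            (embLattice r.emb (fracIdealLattice c (𝔞 : FractionalIdeal _ K)) * Brandt.leftOrder r.lat *
              embLattice r.emb (fracIdealLattice c ((𝔞⁻¹ : (FractionalIdeal (quadOrder K c)⁰ K)ˣ) :
                FractionalIdeal _ K))) *
            embLattice r.emb (fracIdealLattice c (𝔞 : FractionalIdeal _ K)) :=
          mul_le_mul' (mul_le_mul_right hx' _) le_rfl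
        _ = embLattice r.emb (Subalgebra.toSubmodule (quadOrder K c)) * Brandt.leftOrder r.lat *
            embLattice r.emb (Subalgebra.toSubmodule (quadOrder K c)) := by
          rw [show ∀ A A' L : Submodule ℤ D, A' * (A * L * A') * A = (A' * A) * L * (A' * A) from
            fun _ _ _ => by simp only [mul_assoc], hA'A]
        _ ≤ Brandt.leftOrder r.lat * Brandt.leftOrder r.lat * Brandt.leftOrder r.lat :=
          mul_le_mul' (mul_le_mul' hO'L le_rfl) hO'L
        _ ≤ Brandt.leftOrder r.lat :=
          (mul_le_mul_left (leftOrder_mul_leftOrder_le _) _).trans (leftOrder_mul_leftOrder_le _)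
    exact hZ (by simpa using Submodule.mul_mem_mul (Submodule.mem_span_singleton_self (r.emb x)) h1O')
  · intro hx
    have hx' : (ℤ ∙ r.emb x) ≤ Brandt.leftOrder r.lat :=
      (Submodule.span_singleton_le_iff_mem _ _).mpr hx
    have : (ℤ ∙ r.emb x) * embLattice r.emb (Subalgebra.toSubmodule (quadOrder K c)) ≤
        embLattice r.emb (fracIdealLattice c (𝔞 : FractionalIdeal _ K)) * Brandt.leftOrder r.lat *
          embLattice r.emb (fracIdealLattice c ((𝔞⁻¹ : (FractionalIdeal (quadOrder K c)⁰ K)ˣ) :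
            FractionalIdeal _ K)) :=
      calc _ = (ℤ ∙ r.emb x) * (embLattice r.emb (fracIdealLattice c (𝔞 : FractionalIdeal _ K)) *
            embLattice r.emb (fracIdealLattice c ((𝔞⁻¹ : (FractionalIdeal (quadOrder K c)⁰ K)ˣ) :
              FractionalIdeal _ K))) := by rw [hAA']
        _ = embLattice r.emb (fracIdealLattice c (𝔞 : FractionalIdeal _ K)) * (ℤ ∙ r.emb x) *
            embLattice r.emb (fracIdealLattice c ((𝔞⁻¹ : (FractionalIdeal (quadOrder K c)⁰ K)ˣ) :
              FractionalIdeal _ K)) := by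
          rw [← mul_assoc, span_singleton_mul_embLattice_comm]
        _ ≤ _ := mul_le_mul' (mul_le_mul_right hx' _) le_rfl
    exact this (by simpa using Submodule.mul_mem_mul (Submodule.mem_span_singleton_self (r.emb x)) h1O')

/-- **`f(𝔞) I` is a full lattice** when `I` is one, `f(𝒪_c) ⊆ O_L(I)` and `𝔞` is an invertible
fractional `𝒪_c`-ideal: `f(a) I ⊆ f(𝔞) I ⊆ f(a')⁻¹ I` for nonzero `a ∈ 𝔞 ∩ 𝒪_c`,
`a' ∈ 𝔞⁻¹ ∩ 𝒪_c`, and unit translates of full lattices are full. [folklore] -/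
private theorem isFullLattice_embLattice_mul [NeZero c] (hfull : IsFullLattice D r.lat)
    (h : ∀ x : K, x ∈ quadOrder K c → r.emb x ∈ Brandt.leftOrder r.lat) :
    IsFullLattice D (embLattice r.emb (fracIdealLattice c (𝔞 : FractionalIdeal _ K)) * r.lat) := by
  have hA'A := embLattice_fracIdeal_inv_mul (f := r.emb) 𝔞
  have hO'I := embLattice_quadOrder_mul_eq h
  obtain ⟨a, ha0, ha⟩ := FractionalIdeal.exists_ne_zero_mem_isInteger (Units.ne_zero 𝔞)
  obtain ⟨a', ha0', ha'⟩ := FractionalIdeal.exists_ne_zero_mem_isInteger (Units.ne_zero 𝔞⁻¹)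
  have haK : algebraMap (quadOrder K c) K a ≠ 0 := by
    rwa [Ne, FaithfulSMul.algebraMap_eq_zero_iff]
  have haK' : algebraMap (quadOrder K c) K a' ≠ 0 := by
    rwa [Ne, FaithfulSMul.algebraMap_eq_zero_iff]
  let ua : Dˣ := GrossSpace.embUnit r.emb (Units.mk0 _ haK)
  let ua' : Dˣ := GrossSpace.embUnit r.emb (Units.mk0 _ haK')
  have hfg : (ua'⁻¹ • r.lat).FG := (Brandt.isFullLattice_units_smul hfull ua'⁻¹).1
  refine ⟨Submodule.FG.of_le hfg ?_, fun d => ?_⟩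
  · -- `A I ≤ f(a')⁻¹ I` since `f(a') (A I) ⊆ A' A I = O' I = I`
    intro m hm
    rw [mem_units_smul_submodule_iff, inv_inv, Units.smul_def]
    have hle : (ℤ ∙ r.emb (algebraMap (quadOrder K c) K a')) *
        (embLattice r.emb (fracIdealLattice c (𝔞 : FractionalIdeal _ K)) * r.lat) ≤ r.lat :=
      calc _ ≤ embLattice r.emb (fracIdealLattice c ((𝔞⁻¹ : (FractionalIdeal (quadOrder K c)⁰ K)ˣ) :
              FractionalIdeal _ K)) *
            (embLattice r.emb (fracIdealLattice c (𝔞 : FractionalIdeal _ K)) * r.lat) :=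
          mul_le_mul_left ((Submodule.span_singleton_le_iff_mem _ _).mpr
            (apply_mem_embLattice r.emb ha')) _
        _ = r.lat := by rw [← mul_assoc, hA'A, hO'I]
    exact hle (Submodule.mul_mem_mul (Submodule.mem_span_singleton_self _) hm)
  · -- `f(a) I ⊆ A I` and `f(a) I` is full
    obtain ⟨n, hn, hnd⟩ := (Brandt.isFullLattice_units_smul hfull ua).2 d
    refine ⟨n, hn, ?_⟩
    have hle : ua • r.lat ≤ embLattice r.emb (fracIdealLattice c (𝔞 : FractionalIdeal _ K)) * r.lat := by
      rw [Units.smul_def, ← Submodule.span_singleton_mul]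
      exact mul_le_mul_left ((Submodule.span_singleton_le_iff_mem _ _).mpr
        (apply_mem_embLattice r.emb ha)) _
    exact hle hnd

/-- **The action of an invertible `𝒪_c`-ideal preserves Heegner representatives of conductor
`c`** (BD96 §2.3: the action (4) on `H_N(K; c)` "is well-defined"): for a Brandt setup `S`, a
Heegner representative `(f, I)` of conductor `c` and an invertible fractional `𝒪_c`-ideal `𝔞`,
`(f, f(𝔞) I)` is a Heegner representative of conductor `c`. [cite: BertoliniDarmon1996, §2.3 (4)] -/
private theorem IsHeegner.fracIdeal_mul {Nplus Nminus : ℕ} (S : Brandt.XiSetup Nplus Nminus)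
    [NeZero c] (𝔞 : (FractionalIdeal (quadOrder K c)⁰ K)ˣ) {r : GrossRep S.D K}
    (hr : r.IsHeegner S.O c) :
    (⟨r.emb, embLattice r.emb (fracIdealLattice c (𝔞 : FractionalIdeal _ K)) * r.lat⟩ :
      GrossRep S.D K).IsHeegner S.O c := by
  have hO : IsZOrder S.O := isZOrder_iff_isOrder.mpr S.isEichlerOrder.isOrder
  have hopt : ∀ x : K, x ∈ quadOrder K c → r.emb x ∈ Brandt.leftOrder r.lat :=
    fun x hx => (hr.2 x).mpr hx
  have hA'A := embLattice_fracIdeal_inv_mul (f := r.emb) 𝔞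
  have hO'I := embLattice_quadOrder_mul_eq hopt
  have hI : IsInvertibleRightIdeal S.O r.lat := by
    have := hr.1
    rwa [rightIdeals_eq_invertibleRightIdeals_of_isTotallyDefinite S.isTotallyDefinite hO] at this
  refine ⟨?_, fun x => (apply_mem_leftOrder_embLattice_mul_iff 𝔞 hopt x).trans (hr.2 x)⟩
  change embLattice r.emb (fracIdealLattice c (𝔞 : FractionalIdeal _ K)) * r.lat ∈ _
  rw [rightIdeals_eq_invertibleRightIdeals_of_isTotallyDefinite S.isTotallyDefinite hO]
  refine ⟨isFullLattice_embLattice_mul 𝔞 hI.isFullLattice hopt, ?_, ?_⟩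
  · exact (rightOrder_embLattice_mul 𝔞 hopt).trans hI.rightOrderOf_eq
  · obtain ⟨I', h1, h2⟩ := hI.exists_inv
    refine ⟨I' * embLattice r.emb (fracIdealLattice c ((𝔞⁻¹ : (FractionalIdeal (quadOrder K c)⁰ K)ˣ) :
      FractionalIdeal _ K)), ?_, ?_⟩
    · change _ = Brandt.leftOrder _
      rw [leftOrder_embLattice_mul 𝔞 hopt]
      change _ = _ * leftOrderOf r.lat * _
      rw [← h1]
      simp only [mul_assoc]
    · calc _ = I' * ((embLattice r.emb (fracIdealLattice c ((𝔞⁻¹ : (FractionalIdeal (quadOrder K c)⁰ K)ˣ) :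
              FractionalIdeal _ K)) * embLattice r.emb (fracIdealLattice c (𝔞 : FractionalIdeal _ K))) *
            r.lat) := by simp only [mul_assoc]
        _ = S.O := by rw [hA'A, hO'I, h2]


end GrossRepCopy

end NormCompatAux

end Literature.NumberTheory.EllipticCurves


namespace Literature.NumberTheory.EllipticCurves

universe u''

namespace GrossPointTowerNormCompat

open QuadOrderTower GrossPointTowerNorm Literature.NumberTheory.Automorphic GrossRep
open scoped Matrix

variable {K : Type u''} [Field K] [NumberField K] {Nplus Nminus : ℕ} {S : Brandt.XiSetup Nplus Nminus}

/-- `Pic(𝒪_c)` preserves Heegner representatives of conductor `c` (BD96 §2.3 (4), "well defined"):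
the hypothesis `HeegnerStable` of the lattice-level norm relation holds for every Brandt setup
(`GrossRep.IsHeegner.fracIdeal_mul`, here through a private copy). [cite: BertoliniDarmon1996, §2.3 (4)] -/
theorem _root_.Literature.NumberTheory.EllipticCurves.GrossPointTowerNorm.HeegnerStable_holds :
    HeegnerStable S K := by
  intro c _ 𝔞 f I hI
  exact NormCompatAux.IsHeegner.fracIdeal_mul S 𝔞 (r := ⟨f, I⟩) hI

variable (K) (p : ℕ) [hp : Fact p.Prime]

/-- The `p`-adic identity behind Prop. 2.7: if `α² − aα + p = 0` and `u = α⁻¹` then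
`u^{n+2} (a Y₁ − Y₀) − p u^{n+3} Y₁ = u^{n+1} Y₁ − u^{n+2} Y₀`. [cite: BertoliniDarmon1996, Prop. 2.7] -/
theorem alpha_identity (α : ℤ_[p]ˣ) (a : ℤ) (hα : (α : ℤ_[p]) ^ 2 - a * α + p = 0) (n : ℕ) (Y₁ Y₀ : ℤ_[p]) :
    ((α⁻¹ ^ (n + 2) : ℤ_[p]ˣ) : ℤ_[p]) * (a * Y₁ - Y₀) -
        ((α⁻¹ ^ (n + 3) : ℤ_[p]ˣ) : ℤ_[p]) * (p * Y₁) =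
      ((α⁻¹ ^ (n + 1) : ℤ_[p]ˣ) : ℤ_[p]) * Y₁ - ((α⁻¹ ^ (n + 2) : ℤ_[p]ˣ) : ℤ_[p]) * Y₀ := by
  set u : ℤ_[p] := ((α⁻¹ : ℤ_[p]ˣ) : ℤ_[p]) with hu
  have hαu : (α : ℤ_[p]) * u = 1 := by rw [hu, Units.mul_inv]
  have h1 : 1 - (a : ℤ_[p]) * u + (p : ℤ_[p]) * u ^ 2 = 0 := by
    linear_combination u ^ 2 * hα - (1 + (α : ℤ_[p]) * u - a * u) * hαu
  simp only [Units.val_pow_eq_pow_val, ← hu]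
  linear_combination (-(u ^ (n + 1) * Y₁)) * h1

variable {K p}

/-- **Prop. 2.7 of Bertolini–Darmon 1996 (compatibility of the theta elements), proved**: the
norm relations of §2.4 (`norm_relation`, from Eichler's count of the `p + 1` neighbours, the
Galois-equivariance of the `p`-neighbour structure and the fibres `{[𝔞_k]σ₀}` of
`Pic(𝒪_{p^{n+2}}) → Pic(𝒪_{p^{n+1}})`) give `Σ_{res σ = τ} z_{n+2}(σ) = z_{n+1}(τ)` via
`α² = aα − p`, i.e. `θ_{n+2} ↦ θ_{n+1}` under `ℤ_p[G_{n+2}] → ℤ_p[G_{n+1}]`. [cite: BertoliniDarmon1996, Prop. 2.7] -/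
theorem isNormCompatible [Fintype (Brandt.ClassSet S.O)] (hK : IsImaginaryQuadratic K)
    (hpN : ¬ p ∣ Nplus * Nminus) (φ : Brandt.ClassSet S.O → ℤ) (a : ℤ)
    (hφ : Brandt.matrix S.O p *ᵥ φ = a • φ) (α : ℤ_[p]ˣ) (hα : (α : ℤ_[p]) ^ 2 - a * α + p = 0)
    (T : GrossPointTower K S p) : T.IsNormCompatible p φ α := by
  classical
  rw [GrossPointTower.IsNormCompatible, mem_completedGroupRing_iff]
  intro n
  obtain ⟨b, hb⟩ := exists_basis_zero_eq_one (K := K) hK.1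
  have hc : p ^ (n + 1) = p ^ n * p := pow_succ p n
  have hd : p ^ (n + 2) = p ^ (n + 1) * p := pow_succ p (n + 1)
  have hpc : p ∣ p ^ (n + 1) := dvd_pow_self p n.succ_ne_zero
  have hcd : p ^ (n + 1) ∣ p ^ (n + 2) := Dvd.intro p hd.symm
  have hec : p ^ n ∣ p ^ (n + 1) := Dvd.intro p hc.symm
  by_cases hfin : Finite (ClassGroup (quadOrder K (p ^ (n + 2))))
  · haveI := Fintype.ofFinite (ClassGroup (quadOrder K (p ^ (n + 2))))
    have hfin' : Finite (ClassGroup (quadOrder K (p ^ (n + 1)))) :=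
      (finite_classGroup_iff hK.1 hpc hd).mp hfin
    haveI := Fintype.ofFinite (ClassGroup (quadOrder K (p ^ (n + 1))))
    rw [GrossPointTower.theta_eq_sum, GrossPointTower.theta_eq_sum, map_sum]
    -- push the projection through `single` and regroup along the fibres
    have hproj : ∀ σ : ClassGroup (quadOrder K (p ^ (n + 2))),
        groupRingProj K p n (MonoidAlgebra.single σ⁻¹ (T.z p φ α (n + 1) σ)) =
          MonoidAlgebra.single (picRes K hcd σ)⁻¹ (T.z p φ α (n + 1) σ) := fun σ => by
      change MonoidAlgebra.mapDomain (picRes K hcd) (MonoidAlgebra.single σ⁻¹ (T.z p φ α (n + 1) σ)) = _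
      rw [MonoidAlgebra.mapDomain_single, map_inv]
    simp_rw [hproj]
    rw [← Finset.sum_fiberwise Finset.univ (picRes K hcd)
      (fun σ => MonoidAlgebra.single (picRes K hcd σ)⁻¹ (T.z p φ α (n + 1) σ))]
    refine Finset.sum_congr rfl fun τ _ => ?_
    -- on the fibre over `τ` the group element is constant
    have hconst : ∀ σ ∈ Finset.univ.filter (fun σ => picRes K hcd σ = τ),
        MonoidAlgebra.single (picRes K hcd σ)⁻¹ (T.z p φ α (n + 1) σ) =
          MonoidAlgebra.single τ⁻¹ (T.z p φ α (n + 1) σ) := fun σ hσ => by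
      rw [(Finset.mem_filter.mp hσ).2]
    rw [Finset.sum_congr rfl hconst]
    simp only [← MonoidAlgebra.singleAddHom_apply, ← map_sum]
    congr 1
    -- the fibre sum of `z_{n+2}` is `z_{n+1}`
    obtain ⟨σ₀, rfl⟩ := picRes_surjective (K := K) hK.1 hpc hd τ
    have hNR := norm_relation hb hK HeegnerStable_holds hpN hpc hc hd φ a hφ (T.mem_grossPoints (n + 2))
      (T.mem_grossPoints (n + 1)) (T.mem_grossPoints n) (T.isPNeighbour (n + 1)) (T.isPNeighbour n) σ₀
    have hcard := card_filter_picRes_eq hb hK hpc hd σ₀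
    -- expand `z`
    simp only [GrossPointTower.z, GrossPointTower.y]
    rw [Finset.sum_sub_distrib, ← Finset.mul_sum, ← Finset.mul_sum]
    have hsum1 : ∑ σ ∈ Finset.univ.filter (fun σ => picRes K hcd σ = picRes K hcd σ₀),
        ((σ • T.pt (n + 1 + 1)).yValue S φ : ℤ_[p]) =
        (a : ℤ_[p]) * ((picRes K hcd σ₀ • T.pt (n + 1)).yValue S φ : ℤ_[p]) -
          ((picRes K hec (picRes K hcd σ₀) • T.pt n).yValue S φ : ℤ_[p]) := by
      rw [← Int.cast_sum, hNR]; push_cast; ring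
    have hsum2 : ∑ σ ∈ Finset.univ.filter (fun σ => picRes K hcd σ = picRes K hcd σ₀),
        ((picRes K hcd σ • T.pt (n + 1)).yValue S φ : ℤ_[p]) =
        (p : ℤ_[p]) * ((picRes K hcd σ₀ • T.pt (n + 1)).yValue S φ : ℤ_[p]) := by
      rw [Finset.sum_congr rfl (fun σ hσ => by rw [(Finset.mem_filter.mp hσ).2]), Finset.sum_const, hcard,
        nsmul_eq_mul]
    rw [hsum1, hsum2]
    exact alpha_identity p α a hα n _ _
  · have hfin' : ¬ Finite (ClassGroup (quadOrder K (p ^ (n + 1)))) := fun h =>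
      hfin ((finite_classGroup_iff hK.1 hpc hd).mpr h)
    rw [GrossPointTower.theta, dif_neg hfin, GrossPointTower.theta, dif_neg hfin', map_zero]

end GrossPointTowerNormCompat

/-- **Discharge of the named fact `grossPointTower_isNormCompatible`** (BD96 Prop. 2.7: "the
elements `θ_n` are compatible under the natural projections"): for every tower of Gross points of
an ordinary Brandt setup, `(θ_{n+1})_n ∈ ℤ_p⟦G_∞⟧`. [cite: BertoliniDarmon1996, Prop. 2.7] -/
theorem grossPointTower_isNormCompatible_holds :
    ∀ (K : Type u'') [Field K] [NumberField K] {Nplus Nminus : ℕ}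
      (S : Literature.NumberTheory.Automorphic.Brandt.XiSetup Nplus Nminus) (p : ℕ) [Fact p.Prime],
      grossPointTower_isNormCompatible K S p := by
  intro K _ _ Nplus Nminus S p _ _ hK _ _ hpN φ a hφ α hα T
  exact GrossPointTowerNormCompat.isNormCompatible hK hpN φ a hφ α hα T

end Literature.NumberTheory.EllipticCurves

end
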